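import Literature.MathematicalPhysics.QuantumFieldTheory.Balaban1983to89.B16RLeafRecord12
import Literature.MathematicalPhysics.QuantumFieldTheory.Balaban1983to89.Node00.Record12PresentSlots

/-!
# `Balaban1983to89.B16RLeafRecord12Live` — YM-DAG nodes N13∕N11 · the 𝐑-LEAF OF RECORD AT STAGE 12 ON THE LIVE-SELECTOR BRANCH: an idempotent selector
# that MOVES ONLY DEAD SEQUENCES (zero fibre mass of the pre-𝐑 term — equivalently NON-LIVE ones) ([Balaban1989LargeFieldI] (0.3) p. 176, (i)–(ii) p. 177;
# [Balaban1988Convergent] p. 244, Thm 1 p. 262, Thm 2 p. 263; [Balaban1989LargeFieldII] Thm 1 p. 355), and THE N11∕N13 JUNCTION COMPOSED BY NAME on that branch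

statement-level bookkeeping over published theorems with citation tags; kernel-checked compositions of tree theorems;
nothing here is a claim about the Yang–Mills mass gap.

Cell `pub-ymgap` (HUMAN RULING D-0062, Track A), seat `pub-ymgap-dag-n11-e` (R134 fan-out row N11∕s3, director-ym verbatim: «`ThmP245Printed` :375 via `rOperation`
from N13's `ROpLeaf` (pairs with n13-c)»), generation 4; filed `--supports` the route's K1′ `StabilityBAtRecordR12e` (count-neutral lineage tag).  [III] =
[Balaban1988Convergent], [IV] = [Balaban1989LargeFieldI], [B16] = [Balaban1989LargeFieldII].  SUCCESSOR MODULE of this seat's `…B16RLeafRecord12` (v1.1; imported,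
never restated): that file's §2∕§5 inhabit `ROpLeaf (VOfRecord₁₂ θ p)` for idempotent selectors moving only 𝐓-ABSENT sequences (zero pre-𝐑 slot, resp. σ-absent);
THIS file replaces «absent» by the WEAKEST clause def-R's (0.3) 𝐑-step actually consumes — «DEAD» — and shows it coincides with the negation of the «LIVE» notion
the K0′ witness-to-be is built on (seat node00-def-K0a, `Node00/Record12LiveSelector.lean`, announced pub-ymgap INBOX l.14317: `LiveSeq … f s := ∃ V, f s V ≠ 0 ∧
∫⌈_{Z′(s)} t_s (V) ≠ 0`; its selector is the identity on live sequences and carries every other sequence onto a live one).  No declaration of that module is used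
or restated here (θ-generic file, no import of it): the non-live clause below is the NEGATED BODY of `LiveSeq` at the pre-𝐑 slot family, so `¬ LiveSeq …` feeds it
by unfolding, and the keyed corollaries at the witness are one application each (a later ≤ 80-line module, once that file lands).

THE ONE OBSERVATION (§1, `fibreIntegral_rterm_eq_zero_of_not_live`).  In (0.3) re-indexed by `Z″` (def-R `Node00.rstepOfSel`), a sequence `a` moved onto `a′`
contributes to the new slot of `a′` the ratio `∫⌈_{Z′(a)} t_a ∕ ∫⌈_{Z′(a)} t_{a′}` (`Node00.rratio`), `t_a = χ(a)·(𝐓e^A)(a)`.  The restricted integral `∫⌈_{Z′(a)} t_a`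
is CONSTANT ALONG THE `Z′(a)`-FIBRES (`B15.BasicStep.fibreIntegral_updateFinset`); hence if it is non-zero at one field `V` it is non-zero on the whole fibre through
`V`, NON-LIVENESS («at every field, `(𝐓e^A)(a) = 0` or `∫⌈_{Z′(a)} t_a = 0`») kills `(𝐓e^A)(a)` — so `t_a` — on that fibre, and the integral at `V` integrates `0`:
contradiction.  So NON-LIVE ⟺ DEAD («`∫⌈_{Z′(a)} t_a ≡ 0`», `forall_fibreIntegral_rterm_eq_zero_iff_not_live`), a dead sequence contributes `0 ∕ (…) = 0` wherever
it is carried (`rratio_eq_zero_of_dead`), and v1.0's fixed-point algebra goes through with «only absent sequences selected onto `a′`» weakened to «only dead ones»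
(`rstepOfSel_TexpA_of_fix_of_dead`; an absent sequence is dead: `fibreIntegral_rterm_eq_zero_of_TexpA_eq_zero`).

CONTENTS (0 `sorry`, 0 `def`, standard axioms; every ingredient BY NAME).
§1 (kernel, generic over def-R's `rstepOfSel`; then at the slot operation of record and at the Stage-12 slot families): the lemmas just named ·
   `rstepSlotOfRecord_of_fix_of_dead` · `slotsOfRecord₁₂_succ_eq_slotsT_of_fix_of_dead` (post-𝐑 slot = pre-𝐑 slot on the `χ_{k+1}(s′)`-support at a fixed point onto
   which only dead sequences are selected, under `Provisos₁₂.base.rstep`) · `fibreIntegral_termT₁₂_eq_zero_of_slotsT_eq_zero` (absent ⇒ dead) ·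
   `fibreIntegral_termT₁₂_eq_zero_of_not_live` (non-live ⇒ dead) — the last two are the inclusions «§2∕§5 of v1.0 ⊆ this branch ⊇ the live selector».
§2 ★ THE LEAF ON THE DEAD-MOVING (= LIVE-SELECTOR) BRANCH: `sLaw₁₂_succ_of_tLaw₁₂_of_idem_of_dead` (`TLaw₁₂ k → SLaw₁₂ (k+1)` with the SAME witnesses) ·
   `rOpLeaf_VOfRecord₁₂_of_idem_of_dead` · `…_of_inInterval` · world form `rOperation_leavesP_of_idem_of_dead₁₂`; NON-LIVE currency (hypothesis = the negated body of
   `LiveSeq` at `f := slotsTOfRecord … p g (k+1)`): `sLaw₁₂_succ_of_tLaw₁₂_of_idem_of_notLive` · `rOpLeaf_VOfRecord₁₂_of_idem_of_notLive` · `…_of_inInterval`.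
§3 ★ THE N11∕N13 JUNCTION COMPOSED BY NAME on that branch (v1.0 §4's faces with «absent» ↦ «dead» ∕ «non-live»): `sLaw₁₂_all_of_thmP245_of_idem_of_dead` (THEOREM 1
   [III] at the Stage-12 objects of record from N11's ONE slot (S1ᵀ) ALONE) · `densitiesDescribed_at_record₁₂_of_idem_of_dead` · `b14_main_at_record₁₂_of_idem_of_dead`
   (THE NODE, no 𝐑-reading hypothesis) · `b14_main_of_isRecordOfRecord₁₂C_datum_of_idem_of_dead` (K1′ `stub_nodes12` binder shape) ·
   `thm1Printed_datumOfRecord₁₂_of_laws_of_idem_of_dead` ∕ `…_of_thmP245I_of_idem_of_dead` (THE ROUTE's (B)-FACE FIRST CONJUNCT from the Theorem of p. 245 alone) ·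
   non-live twins `sLaw₁₂_all_of_thmP245_of_idem_of_notLive` · `b14_main_at_record₁₂_of_idem_of_notLive` · `b14_main_of_isRecordOfRecord₁₂C_datum_of_idem_of_notLive` ·
   `thm1Printed_datumOfRecord₁₂_of_laws_of_idem_of_notLive`.

HONEST FRAMING — READ THIS BEFORE CITING §2 OR §3.  Count-neutral kernel bookkeeping plus ONE fibre-constancy lemma; nothing of Bałaban's is asserted: not
Theorem 1 [B16], not (1.1)–(1.2) [IV], not the Theorem of p. 245 ∕ Thms 1–2 [III], no estimate; `(h : θ.Provisos₁₂ F N)` (K0′-type content), admissibility, the signs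
`0 ≤ κ, E₀, B₀`, the non-negative history ∕ coupling window, the two selector clauses and (S1ᵀ) are DISPLAYED hypotheses.  ON THIS BRANCH 𝐑 INTEGRATES OUT ONLY
DEAD TERMS — terms whose restricted integral over their own renormalised region vanishes identically, i.e. which carry NO mass through (0.3)∕(0.4): every live
(present-with-mass) slot is multiplied by `∫⌈t_{s′}∕∫⌈t_{s′} + Σ(zero ratios) = 1` on its support, so the leaf's content `TLaw₁₂ k → SLaw₁₂ (k+1)` is again the
p. 262 weakening of the 𝐓-image laws and NOTHING of [B16]'s renormalisation of large-field boundary terms WITH mass ([IV] p. 177 (i)–(ii) after `Nmem` steps,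
[B16] (1.100)–(1.101)) is exercised.  CONSEQUENCE FOR READERS OF K0′∕K1′ (LOCATED, not a claim, not a second gap): at a record on this branch — in particular at a
witness whose selector is the live selector — ALL of Theorem 1's analytic burden sits in N11's slot (S1ᵀ) (`∀ k < K, SLaw₁₂ k → TLaw₁₂ k`: [III] Sects. 1–3 with
Thm 2 at the objects of record, for EVERY `k < K`), exactly as v1.0's header says of the absent-moving branch; whether (S1ᵀ) holds at such a record at the levels
where print's 𝐑 is NOT trivial is the discharge question of N11∕N13, untouched here.  At a record with a genuine 𝐑 the currency is v1.0 §3∕§4's `…absorbPresent`.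
N11 and N13 are NOT discharged by this file.  Every theorem reads levels `k < p.K` only (director-ym LINE №118's level guard on `SlotsNondegenerate` is orthogonal).
One finite four-torus programme at fixed `ε`, Bałaban AS PRINTED with locators; nothing continuum ∕ ℝ⁴ ∕ OS ∕ mass gap ∕ Clay.  No `sorry`, no `def`, no
`instance`, no `notation`.
Sources: T. Bałaban, CMP **119** (1988) 243–285 [III] p. 244, Theorem p. 245, (2.18) p. 257, Thm 1 p. 262, remark p. 262, Thm 2 p. 263, (3.24)–(3.25) p. 270;
CMP **122** (1989) 175–202 [IV] (0.2)–(0.4) p. 176, (i)–(ii) p. 177, Prop. 1 (1.1)–(1.2) p. 177; CMP **122** (1989) 355–392 [B16] Thm 1 p. 355, (1.100)–(1.101)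
pp. 390–391.

v1.1 (same seat; APPEND-ONLY — every v1.0 declaration byte-identical; one import added, `Node00.Record12PresentSlots`, for node00-def-K0b's Fubini-over-a-fibre
lemma `exists_ne_zero_and_fibreIntegral_ne_zero`, cited by name): §4 ★ 𝐑 OF RECORD IS THE IDENTITY ALMOST EVERYWHERE ON THE LIVE-SELECTOR BRANCH — the HONEST
LABEL above in kernel form.  A dead term is a.e. ZERO under the (0.3) provisos (`ae_eq_zero_of_dead`: non-negative, bounded, measurable, all fibre integrals zero ⇒
`∫ t = 0` by K0b's lemma read contrapositively ⇒ `t = 0` a.e.); hence for an idempotent selector moving only dead sequences EVERY summand of (0.3) re-indexed by `Z″`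
agrees a.e. with the corresponding summand of (2.18) (`chi_mul_rstepOfSel_TexpA_ae_eq_rterm_of_idem_of_dead`: fixed points pointwise by §1, moved sequences `0 = t_a`
a.e.), so `(𝐑ρ) = ρ` a.e. (`sum_rstepOfSel_ae_eq_sum_of_idem_of_dead`, `ropReal_ae_eq_total_of_idem_of_dead` — generic over def-R's `rstepOfSel`), and at the Stage-12
record `ρ_{k+1} = 𝐓ρ_k` a.e. for every `k < K` (`densOfRecord₁₂_succ_ae_eq_tdens_of_idem_of_dead` ∕ `…_of_idem_of_notLive`): on this branch — node00-def-K0a's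
live-selector witness included — the operation 𝐑 of record changes NO density of the run beyond a null set; what [B16] exists to do is not done at such a record.
LOCATED for the K0′∕K1′ readers and the planner; count-neutral; nothing of Bałaban asserted.
-/

noncomputable section

open MeasureTheory
open scoped BigOperators Matrix.Norms.L2Operator

namespace Literature.MathematicalPhysics.QuantumFieldTheory.Balaban1983to89.B16RLeafRecord12Live

open T4Continuum T4DatumAssembly Node00 B14.Eq218Concrete DagBinding
open B16RLeafRecord11 B14NodeKnitRecord12R B16RLeafRecord12

variable (F : T4Family) (N : ℕ) [NeZero N]

/-! ## §1  DEAD SEQUENCES under def-R's (0.3) 𝐑-step: absent ⇒ dead, non-live ⟺ dead, dead ratios vanish, fixed points receiving only dead sequences -/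

section RStep

variable {P : Params} {G : Type*} [GaugeGroup G] [MeasurableSpace G] [HaarData G] {j : ℕ}

/-- **AN ABSENT TERM IS DEAD** (generic): if the slot `(𝐓e^A)(a)` is the zero function then the restricted integral `∫⌈_{Z′(a)} t_a` of the term
`t_a = χ(a)·(𝐓e^A)(a)` vanishes at every field (def-R's `rterm_eq_zero_of_TexpA`, `fibreIntegral_zero_fun`) — v1.0 §2's «absent» clause is a case of «dead».
The `DecidableEq (PBond …)` instance is an implicit binder (unified with the caller's). [cite: Balaban1989LargeFieldI, (0.3) p.176 (bookkeeping)] -/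
theorem fibreIntegral_rterm_eq_zero_of_TexpA_eq_zero {hP : DecidableEq (PBond P j)} (r : Step.Repr218 P G j)
    (fib : r.Adm → Finset (PBond P j)) (a : r.Adm) (h0 : r.TexpA a = 0) (V : GaugeField P j G) :
    B15.BasicStep.fibreIntegral (fib a) (rterm r a) V = 0 := by
  rw [rterm_eq_zero_of_TexpA r a fun W => by rw [h0, Pi.zero_apply]]
  exact fibreIntegral_zero_fun (fib a) V

/-- **★ A NON-LIVE TERM IS DEAD** (generic; the one observation of this file): if at EVERY field `V` either the slot `(𝐓e^A)(a)(V)` vanishes or the restricted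
integral `∫⌈_{Z′(a)} t_a (V)` does («`a` is not live»), then `∫⌈_{Z′(a)} t_a ≡ 0` IDENTICALLY.  Reason: the restricted integral is constant along the
`Z′(a)`-fibres (`B15.BasicStep.fibreIntegral_updateFinset`), so were it non-zero at `V` it would be non-zero on the whole fibre through `V`, non-liveness would
kill `(𝐓e^A)(a)` — hence `t_a` — on that fibre, and the integral at `V` would integrate `0`. [cite: Balaban1989LargeFieldI, (0.3) p.176 («∫dV⌈_{Z′}», the restricted integral); Balaban1988Convergent, (2.18) p.257] -/
theorem fibreIntegral_rterm_eq_zero_of_not_live {hP : DecidableEq (PBond P j)} (r : Step.Repr218 P G j)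
    (fib : r.Adm → Finset (PBond P j)) (a : r.Adm)
    (hnl : ¬ ∃ V, r.TexpA a V ≠ 0 ∧ B15.BasicStep.fibreIntegral (fib a) (rterm r a) V ≠ 0) (V : GaugeField P j G) :
    B15.BasicStep.fibreIntegral (fib a) (rterm r a) V = 0 := by
  by_contra hV
  have hzero : ∀ y : ↥(fib a) → G, rterm r a (Function.updateFinset V (fib a) y) = 0 := by
    intro y
    have hW : B15.BasicStep.fibreIntegral (fib a) (rterm r a) (Function.updateFinset V (fib a) y) ≠ 0 := by
      rw [B15.BasicStep.fibreIntegral_updateFinset]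
      exact hV
    have hT : r.TexpA a (Function.updateFinset V (fib a) y) = 0 := by
      by_contra hT
      exact hnl ⟨_, hT, hW⟩
    show r.χ a _ * r.TexpA a _ = 0
    rw [hT, mul_zero]
  apply hV
  simp only [B15.BasicStep.fibreIntegral, MeasureTheory.lmarginal, hzero, ENNReal.ofReal_zero, MeasureTheory.lintegral_const, zero_mul,
    ENNReal.toReal_zero]

/-- **A DEAD TERM IS NOT LIVE** (the converse, trivial), so that together with `fibreIntegral_rterm_eq_zero_of_not_live`: DEAD ⟺ NON-LIVE.
[cite: Balaban1989LargeFieldI, (0.3) p.176 (bookkeeping)] -/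
theorem forall_fibreIntegral_rterm_eq_zero_iff_not_live {hP : DecidableEq (PBond P j)} (r : Step.Repr218 P G j)
    (fib : r.Adm → Finset (PBond P j)) (a : r.Adm) :
    (∀ V, B15.BasicStep.fibreIntegral (fib a) (rterm r a) V = 0) ↔
      ¬ ∃ V, r.TexpA a V ≠ 0 ∧ B15.BasicStep.fibreIntegral (fib a) (rterm r a) V ≠ 0 :=
  ⟨fun h ⟨V, _, hV⟩ => hV (h V), fibreIntegral_rterm_eq_zero_of_not_live r fib a⟩

/-- **A LIVE FIELD FROM ONE NON-VANISHING RESTRICTED INTEGRAL** (contrapositive reading): if `∫⌈_{Z′(a)} t_a (V) ≠ 0` at some field then `a` is live — some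
field carries both a non-zero slot value and a non-zero restricted integral. [cite: Balaban1989LargeFieldI, (0.3) p.176 (bookkeeping)] -/
theorem exists_live_of_fibreIntegral_rterm_ne_zero {hP : DecidableEq (PBond P j)} (r : Step.Repr218 P G j)
    (fib : r.Adm → Finset (PBond P j)) (a : r.Adm) (V : GaugeField P j G)
    (hV : B15.BasicStep.fibreIntegral (fib a) (rterm r a) V ≠ 0) :
    ∃ W, r.TexpA a W ≠ 0 ∧ B15.BasicStep.fibreIntegral (fib a) (rterm r a) W ≠ 0 := by
  by_contra h
  exact hV (fibreIntegral_rterm_eq_zero_of_not_live r fib a h V)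

/-- **A DEAD SEQUENCE CONTRIBUTES NOTHING WHEREVER IT IS CARRIED**: its (0.3) ratio `∫⌈_{Z′(a)} t_a ∕ ∫⌈_{Z′(a)} t_{a′}` is `0 ∕ (…) = 0` at every field, for
every target `a′`. [cite: Balaban1989LargeFieldI, (0.3) p.176] -/
theorem rratio_eq_zero_of_dead {hP : DecidableEq (PBond P j)} (r : Step.Repr218 P G j) (fib : r.Adm → Finset (PBond P j)) (a : r.Adm)
    (hdead : ∀ V, B15.BasicStep.fibreIntegral (fib a) (rterm r a) V = 0) (a' : r.Adm) (V : GaugeField P j G) :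
    rratio r fib a a' V = 0 := by
  rw [rratio, hdead V, zero_div]

open Classical in
/-- **ON A FIXED POINT `a′` OF THE SELECTOR ONTO WHICH ONLY DEAD SEQUENCES ARE SELECTED, THE 𝐑-STEPPED SLOT IS UNCHANGED ON THE χ-SUPPORT** (generic): with
`sel a′ = a′` and `∫⌈_{Z′(a)} t_a ≡ 0` for every OTHER `a` with `sel a = a′`, the 𝐑-factor `Σ_{a : sel a = a′} ∫⌈_{Z′(a)} t_a ∕ ∫⌈_{Z′(a)} t_{a′}` reduces to its
diagonal term, which is `1` where `∫⌈ t_{a′} ≠ 0`; where it vanishes, the support-form proviso and `χ(a′)(V) ≠ 0` give `(𝐓e^A)(a′)(V) = 0` and `0·(0∕0) = 0`.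
v1.0's `rstepOfSel_TexpA_of_fix_of_absent` is the sub-case «absent» (`fibreIntegral_rterm_eq_zero_of_TexpA_eq_zero`); the LIVE SELECTOR (identity on live sequences,
the others — all dead by `fibreIntegral_rterm_eq_zero_of_not_live` — carried onto live ones) is the case this lemma is written for.
[cite: Balaban1989LargeFieldI, (0.3) p.176, p.177 (i)–(ii)] -/
theorem rstepOfSel_TexpA_of_fix_of_dead {hP : DecidableEq (PBond P j)} (r : Step.Repr218 P G j) (sel : r.Adm → r.Adm)
    (fib : r.Adm → Finset (PBond P j)) (a' : r.Adm) (hfix : sel a' = a')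
    (hdead : ∀ a, sel a = a' → a ≠ a' → ∀ V, B15.BasicStep.fibreIntegral (fib a) (rterm r a) V = 0)
    (V : GaugeField P j G) (hsupp : B15.BasicStep.fibreIntegral (fib a') (rterm r a') V = 0 → rterm r a' V = 0) (hχ : r.χ a' V ≠ 0) :
    (rstepOfSel r sel fib).TexpA a' V = r.TexpA a' V := by
  rw [rstepOfSel_TexpA]
  have hmem : a' ∈ Finset.univ.filter (fun a => sel a = a') := by simp [hfix]
  rw [Finset.sum_eq_single_of_mem a' hmem ?_]
  · by_cases h0 : B15.BasicStep.fibreIntegral (fib a') (rterm r a') V = 0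
    · have hT : r.TexpA a' V = 0 := by
        rcases mul_eq_zero.1 (hsupp h0) with h | h
        · exact absurd h hχ
        · exact h
      rw [hT, zero_mul]
    · rw [rratio, div_self h0, mul_one]
  · intro a ha hne
    exact rratio_eq_zero_of_dead r fib a (hdead a (Finset.mem_filter.1 ha).2 hne) a' V

end RStep

section SlotOp

variable {F N} (ν : Stage7Numerics) (τ : TowerNumerics)

/-- `R` of record as a slot operation LEAVES THE SLOT UNCHANGED on the `χ_k(s′)`-support AT A FIXED POINT `s′` OF THE SELECTOR ONTO WHICH ONLY DEAD SEQUENCES ARE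
SELECTED (ARBITRARY slot family `f`; «dead» = the restricted integral of the term `χ_k(a)·f(a)` over `Z′(a)` vanishes at every field; the proviso and the dead clause
are stated with the caller's `DecidableEq (PBond …)` instance and bridged to `rstepSlot`'s by subsingleton-`convert`). [cite: Balaban1989LargeFieldI, (0.3) p.176] -/
theorem rstepSlotOfRecord_of_fix_of_dead (ppSel : PpSelOfRecord F ν τ.M) (p : B12.RunParams) (g : ℕ → ℝ) (k : ℕ)
    (f : TexpASlot F N ν τ.M p g k) (s' : SeqOfRecord F ν τ.M g p.K k) (hfix : ppSel p g k s' = s')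
    (hdead : ∀ a, ppSel p g k a = s' → a ≠ s' → ∀ V, B15.BasicStep.fibreIntegral (fibOfSeq F ν τ p g k a)
      (fun U => chiSeqOfRecord F N ν τ.M g p.K k a U * f a U) V = 0)
    (V : GaugeField (F.P p.K) k (SU N))
    (hsupp : B15.BasicStep.fibreIntegral (fibOfSeq F ν τ p g k s')
        (fun U => chiSeqOfRecord F N ν τ.M g p.K k s' U * f s' U) V = 0 →
      chiSeqOfRecord F N ν τ.M g p.K k s' V * f s' V = 0)
    (hχ : chiSeqOfRecord F N ν τ.M g p.K k s' V ≠ 0) :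
    rstepSlotOfRecord F N ν τ ppSel p g k f s' V = f s' V := by
  unfold rstepSlotOfRecord rstepSlot
  refine rstepOfSel_TexpA_of_fix_of_dead (sliceOfRecord F N ν τ.M p g k f) (ppSel p g k) (fibOfSeq F ν τ p g k) s' hfix ?_ V ?_ hχ
  · intro a ha hne W
    have H := hdead a ha hne W
    convert H using 2
    rfl
  · intro h0
    apply hsupp
    convert h0 using 2
    rfl

end SlotOp

section AtRecordSlots

variable (θ : Stage12Params F N) (p : B12.RunParams)

/-- **AT THE STAGE-12 RECORD, ON A FIXED POINT `s′` OF `θ.ppSel p g (k+1)` ONTO WHICH ONLY DEAD SEQUENCES ARE SELECTED, THE POST-𝐑 SLOT OF `ρ_{k+1}` IS THE PRE-𝐑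
SLOT OF `𝐓ρ_k` ON THE `χ_{k+1}(s′)`-SUPPORT** — the live-selector case (a dead sequence selected onto `s′` contributes the ratio `0 ∕ ∫⌈t_{s′} = 0`), under
`Provisos₁₂.base.rstep` (def-R's (0.3) provisos of the pre-𝐑 tower of record in support form).  «Dead» is stated on the pre-𝐑 slot family `slotT_{k+1}` with the
term `rterm (sliceOfRecord … slotT_{k+1}) a = χ_{k+1}(a)·slotT_{k+1}(a)`. [cite: Balaban1989LargeFieldI, (0.3) p.176, p.177 (i)–(ii); Balaban1988Convergent, (3.24)–(3.25) p.270] -/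
theorem slotsOfRecord₁₂_succ_eq_slotsT_of_fix_of_dead (h : θ.Provisos₁₂ F N) (k : ℕ) (hk : k < p.K)
    (s' : SeqOfRecord F θ.ν θ.τ9.M (gOfRecord₁₀ F N θ.toStage9Params p) p.K (k + 1))
    (hfix : θ.ppSel p (gOfRecord₁₀ F N θ.toStage9Params p) (k + 1) s' = s')
    (hdead : ∀ a, θ.ppSel p (gOfRecord₁₀ F N θ.toStage9Params p) (k + 1) a = s' → a ≠ s' →
      ∀ V, B15.BasicStep.fibreIntegral (fibOfSeq F θ.ν θ.τ9 p (gOfRecord₁₀ F N θ.toStage9Params p) (k + 1) a)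
        (rterm (sliceOfRecord F N θ.ν θ.τ9.M p (gOfRecord₁₀ F N θ.toStage9Params p) (k + 1)
          (slotsTOfRecord F N θ.ν θ.τ9 (EOfRecord₁₀ F N θ.toStage9Params) (wOfRecord₉ F N θ.toStage9Params) θ.ppSel p
            (gOfRecord₁₀ F N θ.toStage9Params p) (k + 1))) a) V = 0)
    (V : GaugeField (F.P p.K) (k + 1) (SU N))
    (hχ : chiSeqOfRecord F N θ.ν θ.τ9.M (gOfRecord₁₀ F N θ.toStage9Params p) p.K (k + 1) s' V ≠ 0) :
    slotsOfRecord F N θ.ν θ.τ9 (EOfRecord₁₀ F N θ.toStage9Params) (wOfRecord₉ F N θ.toStage9Params) θ.ppSel p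
        (gOfRecord₁₀ F N θ.toStage9Params p) (k + 1) s' V
      = slotsTOfRecord F N θ.ν θ.τ9 (EOfRecord₁₀ F N θ.toStage9Params) (wOfRecord₉ F N θ.toStage9Params) θ.ppSel p
          (gOfRecord₁₀ F N θ.toStage9Params p) (k + 1) s' V := by
  rw [slotsOfRecord_succ]
  refine rstepSlotOfRecord_of_fix_of_dead θ.ν θ.τ9 θ.ppSel p _ (k + 1) _ s' hfix (fun a ha hne W => hdead a ha hne W) V ?_ hχ
  have H := (h.base.rstep p k hk).2.2.2 s' V
  change B15.BasicStep.fibreIntegral (fibOfSeq F θ.ν θ.τ9 p (gOfRecord₁₀ F N θ.toStage9Params p) (k + 1) s')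
      (rterm (repr218OfRecord F N θ.ν θ.τ9.M (slotsTOfRecord F N θ.ν θ.τ9 (EOfRecord₁₀ F N θ.toStage9Params)
        (wOfRecord₉ F N θ.toStage9Params) θ.ppSel) p (gOfRecord₁₀ F N θ.toStage9Params p) (k + 1))
        (θ.ppSel p (gOfRecord₁₀ F N θ.toStage9Params p) (k + 1) s')) V = 0 →
      rterm (repr218OfRecord F N θ.ν θ.τ9.M (slotsTOfRecord F N θ.ν θ.τ9 (EOfRecord₁₀ F N θ.toStage9Params)
        (wOfRecord₉ F N θ.toStage9Params) θ.ppSel) p (gOfRecord₁₀ F N θ.toStage9Params p) (k + 1)) s' V = 0 at H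
  rw [hfix] at H
  exact H

/-- **AN ABSENT 𝐓-SLOT IS DEAD, at the Stage-12 slot families**: if the pre-𝐑 slot `slotT_{k+1}(a)` is the zero function, the restricted integral of its term over
`Z′(a)` vanishes at every field — v1.0 §2's clause «moved ⇒ zero 𝐓-slot» (and §5's «moved ⇒ σ-absent», through K0b's `slotsTOfRecord_succ_eq_zero_of_forall_ne`)
implies this file's «moved ⇒ dead». [cite: Balaban1989LargeFieldI, (0.3) p.176 (bookkeeping); Balaban1988Convergent, (2.17)–(2.18) p.257] -/
theorem fibreIntegral_termT₁₂_eq_zero_of_slotsT_eq_zero (k : ℕ)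
    (a : SeqOfRecord F θ.ν θ.τ9.M (gOfRecord₁₀ F N θ.toStage9Params p) p.K (k + 1))
    (h0 : slotsTOfRecord F N θ.ν θ.τ9 (EOfRecord₁₀ F N θ.toStage9Params) (wOfRecord₉ F N θ.toStage9Params) θ.ppSel p
      (gOfRecord₁₀ F N θ.toStage9Params p) (k + 1) a = 0)
    (V : GaugeField (F.P p.K) (k + 1) (SU N)) :
    B15.BasicStep.fibreIntegral (fibOfSeq F θ.ν θ.τ9 p (gOfRecord₁₀ F N θ.toStage9Params p) (k + 1) a)
        (rterm (sliceOfRecord F N θ.ν θ.τ9.M p (gOfRecord₁₀ F N θ.toStage9Params p) (k + 1)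
          (slotsTOfRecord F N θ.ν θ.τ9 (EOfRecord₁₀ F N θ.toStage9Params) (wOfRecord₉ F N θ.toStage9Params) θ.ppSel p
            (gOfRecord₁₀ F N θ.toStage9Params p) (k + 1))) a) V = 0 :=
  fibreIntegral_rterm_eq_zero_of_TexpA_eq_zero
    (sliceOfRecord F N θ.ν θ.τ9.M p (gOfRecord₁₀ F N θ.toStage9Params p) (k + 1)
      (slotsTOfRecord F N θ.ν θ.τ9 (EOfRecord₁₀ F N θ.toStage9Params) (wOfRecord₉ F N θ.toStage9Params) θ.ppSel p
        (gOfRecord₁₀ F N θ.toStage9Params p) (k + 1)))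
    (fibOfSeq F θ.ν θ.τ9 p (gOfRecord₁₀ F N θ.toStage9Params p) (k + 1)) a h0 V

/-- **A NON-LIVE SEQUENCE IS DEAD, at the Stage-12 slot families** (`fibreIntegral_rterm_eq_zero_of_not_live` read on the pre-𝐑 family `slotT_{k+1}`): the
hypothesis is the NEGATED BODY of node00-def-K0a's `LiveSeq p g (k+1) (slotsTOfRecord … (k+1)) a` («∃ V, slotT_{k+1}(a)(V) ≠ 0 ∧ ∫⌈_{Z′(a)} t_a (V) ≠ 0»), so
`¬ LiveSeq …` feeds it by unfolding. [cite: Balaban1989LargeFieldI, (0.3) p.176; Balaban1988Convergent, (2.18) p.257] -/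
theorem fibreIntegral_termT₁₂_eq_zero_of_not_live (k : ℕ)
    (a : SeqOfRecord F θ.ν θ.τ9.M (gOfRecord₁₀ F N θ.toStage9Params p) p.K (k + 1))
    (hnl : ¬ ∃ V, slotsTOfRecord F N θ.ν θ.τ9 (EOfRecord₁₀ F N θ.toStage9Params) (wOfRecord₉ F N θ.toStage9Params) θ.ppSel p
        (gOfRecord₁₀ F N θ.toStage9Params p) (k + 1) a V ≠ 0 ∧
      B15.BasicStep.fibreIntegral (fibOfSeq F θ.ν θ.τ9 p (gOfRecord₁₀ F N θ.toStage9Params p) (k + 1) a)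
        (rterm (sliceOfRecord F N θ.ν θ.τ9.M p (gOfRecord₁₀ F N θ.toStage9Params p) (k + 1)
          (slotsTOfRecord F N θ.ν θ.τ9 (EOfRecord₁₀ F N θ.toStage9Params) (wOfRecord₉ F N θ.toStage9Params) θ.ppSel p
            (gOfRecord₁₀ F N θ.toStage9Params p) (k + 1))) a) V ≠ 0)
    (V : GaugeField (F.P p.K) (k + 1) (SU N)) :
    B15.BasicStep.fibreIntegral (fibOfSeq F θ.ν θ.τ9 p (gOfRecord₁₀ F N θ.toStage9Params p) (k + 1) a)
        (rterm (sliceOfRecord F N θ.ν θ.τ9.M p (gOfRecord₁₀ F N θ.toStage9Params p) (k + 1)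
          (slotsTOfRecord F N θ.ν θ.τ9 (EOfRecord₁₀ F N θ.toStage9Params) (wOfRecord₉ F N θ.toStage9Params) θ.ppSel p
            (gOfRecord₁₀ F N θ.toStage9Params p) (k + 1))) a) V = 0 :=
  fibreIntegral_rterm_eq_zero_of_not_live
    (sliceOfRecord F N θ.ν θ.τ9.M p (gOfRecord₁₀ F N θ.toStage9Params p) (k + 1)
      (slotsTOfRecord F N θ.ν θ.τ9 (EOfRecord₁₀ F N θ.toStage9Params) (wOfRecord₉ F N θ.toStage9Params) θ.ppSel p
        (gOfRecord₁₀ F N θ.toStage9Params p) (k + 1)))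
    (fibOfSeq F θ.ν θ.τ9 p (gOfRecord₁₀ F N θ.toStage9Params p) (k + 1)) a hnl V

end AtRecordSlots

/-! ## §2  ★ The leaf INHABITED on the dead-moving (= live-selector) branch -/

section LiveBranch

variable (θ : Stage12Params F N) (p : B12.RunParams)

/-- **`TLaw₁₂ k → SLaw₁₂ (k+1)` WHEN THE LEVEL-`k+1` SELECTOR IS IDEMPOTENT AND MOVES ONLY DEAD SEQUENCES**, Stage 12 — the live-selector branch (node00-def-K0a's
θ₀ˡⁱᵛᵉ: `Z ↦ Z″` the identity on LIVE sequences, every other sequence — dead, by `fibreIntegral_termT₁₂_eq_zero_of_not_live` — carried onto a live one): the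
𝐓-image §2 form of `𝐓ρ_k`'s slots (dichotomy form) gives the §2 form of `ρ_{k+1}`'s slots at index `k+1` with the SAME term values and constants — the laws by
p. 262 [III] (`HasSect2FormTAEZ.toFormAEZ_succ` under the signs `0 ≤ β` (admissibility), `0 ≤ κ, E₀, B₀`, `0 ≤ g_{k+1}`, displayed); OFF the range the post-𝐑 slot
is absent (v1.0 §1); ON the range (fixed points, by idempotency) an absent 𝐓-slot stays absent and a present one keeps its a.e. identity along `slot_{k+1}(s′) =
slotT_{k+1}(s′)` on the `χ_{k+1}(s′)`-support (§1: the selected dead sequences contribute zero ratios).  HONEST SCOPE: on this branch 𝐑 integrates out only terms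
of zero fibre mass. [cite: Balaban1988Convergent, §2 p.262, Thm 2 p.263, (3.24)–(3.25) p.270; Balaban1989LargeFieldI, (0.3) p.176, p.177 (i)–(ii)] -/
theorem sLaw₁₂_succ_of_tLaw₁₂_of_idem_of_dead (h : θ.Provisos₁₂ F N) (hθ : θ.Admissible F N) (hκ : 0 ≤ θ.s2.lf.κ) (hE₀ : 0 ≤ θ.s2.lf.E₀)
    (hB₀ : 0 ≤ θ.s2.lf.B₀) (k : ℕ) (hk : k < p.K) (hg : 0 ≤ gOfRecord₁₀ F N θ.toStage9Params p (k + 1))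
    (hidem : ∀ a, θ.ppSel p (gOfRecord₁₀ F N θ.toStage9Params p) (k + 1) (θ.ppSel p (gOfRecord₁₀ F N θ.toStage9Params p) (k + 1) a)
      = θ.ppSel p (gOfRecord₁₀ F N θ.toStage9Params p) (k + 1) a)
    (hdead : ∀ a, θ.ppSel p (gOfRecord₁₀ F N θ.toStage9Params p) (k + 1) a ≠ a →
      ∀ V, B15.BasicStep.fibreIntegral (fibOfSeq F θ.ν θ.τ9 p (gOfRecord₁₀ F N θ.toStage9Params p) (k + 1) a)
        (rterm (sliceOfRecord F N θ.ν θ.τ9.M p (gOfRecord₁₀ F N θ.toStage9Params p) (k + 1)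
          (slotsTOfRecord F N θ.ν θ.τ9 (EOfRecord₁₀ F N θ.toStage9Params) (wOfRecord₉ F N θ.toStage9Params) θ.ppSel p
            (gOfRecord₁₀ F N θ.toStage9Params p) (k + 1))) a) V = 0)
    (hT : TLaw₁₂ F N θ p k) : SLaw₁₂ F N θ p (k + 1) := by
  rw [sLaw₁₂_iff]
  have hA := ((tLaw₁₂_iff F N θ p k).mp hT).toFormAEZ_succ hθ.pos.2.1 hκ hE₀ hB₀ hg
  obtain ⟨t, Ek, hu, hs⟩ := hA
  refine ⟨t, Ek, hu, fun s => ⟨(hs s).1, ?_⟩⟩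
  by_cases hmem : s ∈ Set.range (θ.ppSel p (gOfRecord₁₀ F N θ.toStage9Params p) (k + 1))
  · obtain ⟨b, hb⟩ := hmem
    have hfix : θ.ppSel p (gOfRecord₁₀ F N θ.toStage9Params p) (k + 1) s = s := by rw [← hb]; exact hidem b
    rcases (hs s).2 with h0 | hid
    · exact Or.inl (slotsOfRecord₁₂_succ_eq_zero_of_slotsT_eq_zero F N θ p k s h0)
    · refine Or.inr ?_
      filter_upwards [hid] with V hV hχ
      rw [slotsOfRecord₁₂_succ_eq_slotsT_of_fix_of_dead F N θ p h k hk s hfix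
        (fun a ha hne => hdead a fun heq => hne (heq.symm.trans ha)) V hχ]
      exact hV hχ
  · exact Or.inl (slotsOfRecord₁₂_succ_eq_zero_of_not_mem_range F N θ p k s hmem)

/-- **★ THE 𝐑-LEAF OF RECORD AT STAGE 12, INHABITED ON THE LIVE-SELECTOR BRANCH**: if at every level `k < K` the selector `θ.ppSel p g (k+1)` is idempotent and moves
only dead sequences, then — under the (inhabitable) provisos, admissibility, the displayed signs and `0 ≤ g_{k+1}` — `ROpLeaf (VOfRecord₁₂ F N θ p)`: the junction
Prop node N13 produces and node N11 consumes.  Scope: the branch on which 𝐑 integrates out only terms of zero fibre mass; [B16] Theorem 1's 𝐑-construction is not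
exercised. [cite: Balaban1988Convergent, p.244, Thm 2 p.263, §2 p.262; Balaban1989LargeFieldI, (0.3) p.176, p.177 (i)–(ii); Balaban1989LargeFieldII, Thm 1 p.355 (what the general case needs)] -/
theorem rOpLeaf_VOfRecord₁₂_of_idem_of_dead (h : θ.Provisos₁₂ F N) (hθ : θ.Admissible F N) (hκ : 0 ≤ θ.s2.lf.κ) (hE₀ : 0 ≤ θ.s2.lf.E₀)
    (hB₀ : 0 ≤ θ.s2.lf.B₀) (hg : ∀ k, k < p.K → 0 ≤ gOfRecord₁₀ F N θ.toStage9Params p (k + 1))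
    (hidem : ∀ k, k < p.K → ∀ a, θ.ppSel p (gOfRecord₁₀ F N θ.toStage9Params p) (k + 1)
      (θ.ppSel p (gOfRecord₁₀ F N θ.toStage9Params p) (k + 1) a) = θ.ppSel p (gOfRecord₁₀ F N θ.toStage9Params p) (k + 1) a)
    (hdead : ∀ k, k < p.K → ∀ a, θ.ppSel p (gOfRecord₁₀ F N θ.toStage9Params p) (k + 1) a ≠ a →
      ∀ V, B15.BasicStep.fibreIntegral (fibOfSeq F θ.ν θ.τ9 p (gOfRecord₁₀ F N θ.toStage9Params p) (k + 1) a)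
        (rterm (sliceOfRecord F N θ.ν θ.τ9.M p (gOfRecord₁₀ F N θ.toStage9Params p) (k + 1)
          (slotsTOfRecord F N θ.ν θ.τ9 (EOfRecord₁₀ F N θ.toStage9Params) (wOfRecord₉ F N θ.toStage9Params) θ.ppSel p
            (gOfRecord₁₀ F N θ.toStage9Params p) (k + 1))) a) V = 0) :
    ROpLeaf (VOfRecord₁₂ F N θ p) := by
  rw [rOpLeaf_VOfRecord₁₂_iff]
  intro k hk hT
  exact sLaw₁₂_succ_of_tLaw₁₂_of_idem_of_dead F N θ p h hθ hκ hE₀ hB₀ k hk (hg k hk) (hidem k hk) (hdead k hk) hT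

/-- The same with `0 ≤ g_{k+1}` DISCHARGED by the coupling window of the run AT THE DATUM OF RECORD (`((datumOfRecord₁₂ θ h).C p).flow.InInterval γ K`:
`0 < g_k ≤ γ`, `k ≤ K`; `flow_g_datumOfRecord₁₂`). [cite: Balaban1989LargeFieldII, Thm 1 p.355; Balaban1987RG1, (0.17)–(0.20) pp.255–256] -/
theorem rOpLeaf_VOfRecord₁₂_of_idem_of_dead_of_inInterval (h : θ.Provisos₁₂ F N) (hθ : θ.Admissible F N) (hκ : 0 ≤ θ.s2.lf.κ)
    (hE₀ : 0 ≤ θ.s2.lf.E₀) (hB₀ : 0 ≤ θ.s2.lf.B₀) {γ : ℝ} (hsc : ((datumOfRecord₁₂ F N θ h).C p).flow.InInterval γ p.K)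
    (hidem : ∀ k, k < p.K → ∀ a, θ.ppSel p (gOfRecord₁₀ F N θ.toStage9Params p) (k + 1)
      (θ.ppSel p (gOfRecord₁₀ F N θ.toStage9Params p) (k + 1) a) = θ.ppSel p (gOfRecord₁₀ F N θ.toStage9Params p) (k + 1) a)
    (hdead : ∀ k, k < p.K → ∀ a, θ.ppSel p (gOfRecord₁₀ F N θ.toStage9Params p) (k + 1) a ≠ a →
      ∀ V, B15.BasicStep.fibreIntegral (fibOfSeq F θ.ν θ.τ9 p (gOfRecord₁₀ F N θ.toStage9Params p) (k + 1) a)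
        (rterm (sliceOfRecord F N θ.ν θ.τ9.M p (gOfRecord₁₀ F N θ.toStage9Params p) (k + 1)
          (slotsTOfRecord F N θ.ν θ.τ9 (EOfRecord₁₀ F N θ.toStage9Params) (wOfRecord₉ F N θ.toStage9Params) θ.ppSel p
            (gOfRecord₁₀ F N θ.toStage9Params p) (k + 1))) a) V = 0) :
    ROpLeaf (VOfRecord₁₂ F N θ p) :=
  rOpLeaf_VOfRecord₁₂_of_idem_of_dead F N θ p h hθ hκ hE₀ hB₀
    (fun k hk => by
      have hgk := (hsc (k + 1) hk).1
      rw [flow_g_datumOfRecord₁₂] at hgk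
      exact hgk.le) hidem hdead

/-- **World form for the consumers of the leaf** (N11 ∕ N13 ∕ N24 knits read `(leavesP w P).rOperation` at a world bound over the Stage-12 view, `w.up P = upOfRecord₅C
F N (θ.toStage5₁₂ F N) P`): on the live-selector branch the run's `rOperation` leaf HOLDS (`rOperation_iff_rOpLeaf₁₂` ∘ §2). [cite: Balaban1988Convergent, p.244; Balaban1989LargeFieldII, Thm 1 p.355 (bookkeeping)] -/
theorem rOperation_leavesP_of_idem_of_dead₁₂ (w : WorldP) (hup : w.up p = upOfRecord₅C F N (θ.toStage5₁₂ F N) p) (h : θ.Provisos₁₂ F N)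
    (hθ : θ.Admissible F N) (hκ : 0 ≤ θ.s2.lf.κ) (hE₀ : 0 ≤ θ.s2.lf.E₀) (hB₀ : 0 ≤ θ.s2.lf.B₀)
    (hg : ∀ k, k < p.K → 0 ≤ gOfRecord₁₀ F N θ.toStage9Params p (k + 1))
    (hidem : ∀ k, k < p.K → ∀ a, θ.ppSel p (gOfRecord₁₀ F N θ.toStage9Params p) (k + 1)
      (θ.ppSel p (gOfRecord₁₀ F N θ.toStage9Params p) (k + 1) a) = θ.ppSel p (gOfRecord₁₀ F N θ.toStage9Params p) (k + 1) a)
    (hdead : ∀ k, k < p.K → ∀ a, θ.ppSel p (gOfRecord₁₀ F N θ.toStage9Params p) (k + 1) a ≠ a →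
      ∀ V, B15.BasicStep.fibreIntegral (fibOfSeq F θ.ν θ.τ9 p (gOfRecord₁₀ F N θ.toStage9Params p) (k + 1) a)
        (rterm (sliceOfRecord F N θ.ν θ.τ9.M p (gOfRecord₁₀ F N θ.toStage9Params p) (k + 1)
          (slotsTOfRecord F N θ.ν θ.τ9 (EOfRecord₁₀ F N θ.toStage9Params) (wOfRecord₉ F N θ.toStage9Params) θ.ppSel p
            (gOfRecord₁₀ F N θ.toStage9Params p) (k + 1))) a) V = 0) :
    (leavesP w p).rOperation :=
  (rOperation_iff_rOpLeaf₁₂ F N θ w p hup).2 (rOpLeaf_VOfRecord₁₂_of_idem_of_dead F N θ p h hθ hκ hE₀ hB₀ hg hidem hdead)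

/-- **`TLaw₁₂ k → SLaw₁₂ (k+1)` IN NON-LIVE CURRENCY**: idempotent level-`k+1` selector whose every MOVED sequence is NOT LIVE for the pre-𝐑 slot family — the literal
shape of node00-def-K0a's live selector (its hypothesis here is the negated body of `LiveSeq p g (k+1) (slotsTOfRecord … (k+1)) a`) —; §1's fibre-constancy lemma
turns non-live into dead. [cite: Balaban1988Convergent, §2 p.262, Thm 2 p.263, (3.24)–(3.25) p.270; Balaban1989LargeFieldI, (0.3) p.176, p.177 (i)–(ii)] -/
theorem sLaw₁₂_succ_of_tLaw₁₂_of_idem_of_notLive (h : θ.Provisos₁₂ F N) (hθ : θ.Admissible F N) (hκ : 0 ≤ θ.s2.lf.κ) (hE₀ : 0 ≤ θ.s2.lf.E₀)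
    (hB₀ : 0 ≤ θ.s2.lf.B₀) (k : ℕ) (hk : k < p.K) (hg : 0 ≤ gOfRecord₁₀ F N θ.toStage9Params p (k + 1))
    (hidem : ∀ a, θ.ppSel p (gOfRecord₁₀ F N θ.toStage9Params p) (k + 1) (θ.ppSel p (gOfRecord₁₀ F N θ.toStage9Params p) (k + 1) a)
      = θ.ppSel p (gOfRecord₁₀ F N θ.toStage9Params p) (k + 1) a)
    (hnl : ∀ a, θ.ppSel p (gOfRecord₁₀ F N θ.toStage9Params p) (k + 1) a ≠ a →
      ¬ ∃ V, slotsTOfRecord F N θ.ν θ.τ9 (EOfRecord₁₀ F N θ.toStage9Params) (wOfRecord₉ F N θ.toStage9Params) θ.ppSel p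
          (gOfRecord₁₀ F N θ.toStage9Params p) (k + 1) a V ≠ 0 ∧
        B15.BasicStep.fibreIntegral (fibOfSeq F θ.ν θ.τ9 p (gOfRecord₁₀ F N θ.toStage9Params p) (k + 1) a)
          (rterm (sliceOfRecord F N θ.ν θ.τ9.M p (gOfRecord₁₀ F N θ.toStage9Params p) (k + 1)
            (slotsTOfRecord F N θ.ν θ.τ9 (EOfRecord₁₀ F N θ.toStage9Params) (wOfRecord₉ F N θ.toStage9Params) θ.ppSel p
              (gOfRecord₁₀ F N θ.toStage9Params p) (k + 1))) a) V ≠ 0)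
    (hT : TLaw₁₂ F N θ p k) : SLaw₁₂ F N θ p (k + 1) :=
  sLaw₁₂_succ_of_tLaw₁₂_of_idem_of_dead F N θ p h hθ hκ hE₀ hB₀ k hk hg hidem
    (fun a hne => fibreIntegral_termT₁₂_eq_zero_of_not_live F N θ p k a (hnl a hne)) hT

/-- **★ THE 𝐑-LEAF OF RECORD AT STAGE 12 IN NON-LIVE CURRENCY** (idempotent selectors moving only non-live sequences, at every level `k < K` — node00-def-K0a's live
selector by construction): under the provisos, admissibility, the displayed signs and `0 ≤ g_{k+1}`, `ROpLeaf (VOfRecord₁₂ F N θ p)`.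
[cite: Balaban1988Convergent, p.244, Thm 2 p.263; Balaban1989LargeFieldI, (0.3) p.176, p.177 (i)–(ii); Balaban1989LargeFieldII, Thm 1 p.355 (not exercised on this branch)] -/
theorem rOpLeaf_VOfRecord₁₂_of_idem_of_notLive (h : θ.Provisos₁₂ F N) (hθ : θ.Admissible F N) (hκ : 0 ≤ θ.s2.lf.κ) (hE₀ : 0 ≤ θ.s2.lf.E₀)
    (hB₀ : 0 ≤ θ.s2.lf.B₀) (hg : ∀ k, k < p.K → 0 ≤ gOfRecord₁₀ F N θ.toStage9Params p (k + 1))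
    (hidem : ∀ k, k < p.K → ∀ a, θ.ppSel p (gOfRecord₁₀ F N θ.toStage9Params p) (k + 1)
      (θ.ppSel p (gOfRecord₁₀ F N θ.toStage9Params p) (k + 1) a) = θ.ppSel p (gOfRecord₁₀ F N θ.toStage9Params p) (k + 1) a)
    (hnl : ∀ k, k < p.K → ∀ a, θ.ppSel p (gOfRecord₁₀ F N θ.toStage9Params p) (k + 1) a ≠ a →
      ¬ ∃ V, slotsTOfRecord F N θ.ν θ.τ9 (EOfRecord₁₀ F N θ.toStage9Params) (wOfRecord₉ F N θ.toStage9Params) θ.ppSel p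
          (gOfRecord₁₀ F N θ.toStage9Params p) (k + 1) a V ≠ 0 ∧
        B15.BasicStep.fibreIntegral (fibOfSeq F θ.ν θ.τ9 p (gOfRecord₁₀ F N θ.toStage9Params p) (k + 1) a)
          (rterm (sliceOfRecord F N θ.ν θ.τ9.M p (gOfRecord₁₀ F N θ.toStage9Params p) (k + 1)
            (slotsTOfRecord F N θ.ν θ.τ9 (EOfRecord₁₀ F N θ.toStage9Params) (wOfRecord₉ F N θ.toStage9Params) θ.ppSel p
              (gOfRecord₁₀ F N θ.toStage9Params p) (k + 1))) a) V ≠ 0) :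
    ROpLeaf (VOfRecord₁₂ F N θ p) :=
  rOpLeaf_VOfRecord₁₂_of_idem_of_dead F N θ p h hθ hκ hE₀ hB₀ hg hidem
    (fun k hk a hne => fibreIntegral_termT₁₂_eq_zero_of_not_live F N θ p k a (hnl k hk a hne))

/-- … with `0 ≤ g_{k+1}` DISCHARGED by the coupling window of the run at the datum of record. [cite: Balaban1989LargeFieldII, Thm 1 p.355; Balaban1987RG1, (0.17)–(0.20) pp.255–256] -/
theorem rOpLeaf_VOfRecord₁₂_of_idem_of_notLive_of_inInterval (h : θ.Provisos₁₂ F N) (hθ : θ.Admissible F N) (hκ : 0 ≤ θ.s2.lf.κ)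
    (hE₀ : 0 ≤ θ.s2.lf.E₀) (hB₀ : 0 ≤ θ.s2.lf.B₀) {γ : ℝ} (hsc : ((datumOfRecord₁₂ F N θ h).C p).flow.InInterval γ p.K)
    (hidem : ∀ k, k < p.K → ∀ a, θ.ppSel p (gOfRecord₁₀ F N θ.toStage9Params p) (k + 1)
      (θ.ppSel p (gOfRecord₁₀ F N θ.toStage9Params p) (k + 1) a) = θ.ppSel p (gOfRecord₁₀ F N θ.toStage9Params p) (k + 1) a)
    (hnl : ∀ k, k < p.K → ∀ a, θ.ppSel p (gOfRecord₁₀ F N θ.toStage9Params p) (k + 1) a ≠ a →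
      ¬ ∃ V, slotsTOfRecord F N θ.ν θ.τ9 (EOfRecord₁₀ F N θ.toStage9Params) (wOfRecord₉ F N θ.toStage9Params) θ.ppSel p
          (gOfRecord₁₀ F N θ.toStage9Params p) (k + 1) a V ≠ 0 ∧
        B15.BasicStep.fibreIntegral (fibOfSeq F θ.ν θ.τ9 p (gOfRecord₁₀ F N θ.toStage9Params p) (k + 1) a)
          (rterm (sliceOfRecord F N θ.ν θ.τ9.M p (gOfRecord₁₀ F N θ.toStage9Params p) (k + 1)
            (slotsTOfRecord F N θ.ν θ.τ9 (EOfRecord₁₀ F N θ.toStage9Params) (wOfRecord₉ F N θ.toStage9Params) θ.ppSel p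
              (gOfRecord₁₀ F N θ.toStage9Params p) (k + 1))) a) V ≠ 0) :
    ROpLeaf (VOfRecord₁₂ F N θ p) :=
  rOpLeaf_VOfRecord₁₂_of_idem_of_dead_of_inInterval F N θ p h hθ hκ hE₀ hB₀ hsc hidem
    (fun k hk a hne => fibreIntegral_termT₁₂_eq_zero_of_not_live F N θ p k a (hnl k hk a hne))

end LiveBranch

/-! ## §3  ★ THE N11∕N13 JUNCTION COMPOSED BY NAME on the dead-moving (= live-selector) branch -/

section Junction

variable (θ : Stage12Params F N) (p : B12.RunParams)

/-- **★ THEOREM 1 [III] AT THE STAGE-12 OBJECTS OF RECORD FROM N11's ONE SLOT (S1ᵀ) ALONE, ON THE LIVE-SELECTOR BRANCH** ([Balaban1988Convergent] Thm 1 p. 262;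
its printed proof = START + THE THEOREM OF p. 245 + THE ASSUMED 𝐑 along (0.2)): at a `θ` whose selectors `θ.ppSel p g (k+1)`, `k < K`, are idempotent and move only
dead sequences, the p. 244 assumption `B14.RAssumedP244` at the 𝐑-carriers of record — node N13's product — is §2's THEOREM, so this seat's relative closer
`B14NodeKnitRecord12R.sLaw₁₂_all_of_rAssumedP244` (start = node00-def-T's theorem `sLaw₁₂_zero`) needs ONLY `hT` — the Theorem of p. 245 at the objects of record,
`∀ k < K, SLaw₁₂ θ p k → TLaw₁₂ θ p k` — and the displayed signs: EVERY `ρ_k` of record, `k ≤ K`, has the repaired §2 [III] form of record.  Honest scope in the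
header: on this branch (S1ᵀ) carries the whole analytic burden. [cite: Balaban1988Convergent, Thm 1 p.262; Theorem p.245; p.244; Balaban1989LargeFieldI, (0.3) p.176, p.177 (i)–(ii)] -/
theorem sLaw₁₂_all_of_thmP245_of_idem_of_dead (h : θ.Provisos₁₂ F N) (hθ : θ.Admissible F N) (hκ : 0 ≤ θ.s2.lf.κ) (hE₀ : 0 ≤ θ.s2.lf.E₀)
    (hB₀ : 0 ≤ θ.s2.lf.B₀) (hg : ∀ k, k < p.K → 0 ≤ gOfRecord₁₀ F N θ.toStage9Params p (k + 1))
    (hidem : ∀ k, k < p.K → ∀ a, θ.ppSel p (gOfRecord₁₀ F N θ.toStage9Params p) (k + 1)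
      (θ.ppSel p (gOfRecord₁₀ F N θ.toStage9Params p) (k + 1) a) = θ.ppSel p (gOfRecord₁₀ F N θ.toStage9Params p) (k + 1) a)
    (hdead : ∀ k, k < p.K → ∀ a, θ.ppSel p (gOfRecord₁₀ F N θ.toStage9Params p) (k + 1) a ≠ a →
      ∀ V, B15.BasicStep.fibreIntegral (fibOfSeq F θ.ν θ.τ9 p (gOfRecord₁₀ F N θ.toStage9Params p) (k + 1) a)
        (rterm (sliceOfRecord F N θ.ν θ.τ9.M p (gOfRecord₁₀ F N θ.toStage9Params p) (k + 1)
          (slotsTOfRecord F N θ.ν θ.τ9 (EOfRecord₁₀ F N θ.toStage9Params) (wOfRecord₉ F N θ.toStage9Params) θ.ppSel p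
            (gOfRecord₁₀ F N θ.toStage9Params p) (k + 1))) a) V = 0)
    (hT : ∀ k, k < p.K → SLaw₁₂ F N θ p k → TLaw₁₂ F N θ p k) :
    ∀ k, k ≤ p.K → SLaw₁₂ F N θ p k :=
  sLaw₁₂_all_of_rAssumedP244 F N θ p
    ((rOpLeaf₁₂_iff_rAssumedP244 F N θ p).1 (rOpLeaf_VOfRecord₁₂_of_idem_of_dead F N θ p h hθ hκ hE₀ hB₀ hg hidem hdead)) hT

/-- **THEOREM 1 [III] AT THE STAGE-12 OBJECTS OF RECORD FROM (S1ᵀ) ALONE, non-live currency** (idempotent selectors whose moved sequences are not live — the live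
selector by construction). [cite: Balaban1988Convergent, Thm 1 p.262; Theorem p.245; p.244; Balaban1989LargeFieldI, (0.3) p.176, p.177 (i)–(ii)] -/
theorem sLaw₁₂_all_of_thmP245_of_idem_of_notLive (h : θ.Provisos₁₂ F N) (hθ : θ.Admissible F N) (hκ : 0 ≤ θ.s2.lf.κ) (hE₀ : 0 ≤ θ.s2.lf.E₀)
    (hB₀ : 0 ≤ θ.s2.lf.B₀) (hg : ∀ k, k < p.K → 0 ≤ gOfRecord₁₀ F N θ.toStage9Params p (k + 1))
    (hidem : ∀ k, k < p.K → ∀ a, θ.ppSel p (gOfRecord₁₀ F N θ.toStage9Params p) (k + 1)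
      (θ.ppSel p (gOfRecord₁₀ F N θ.toStage9Params p) (k + 1) a) = θ.ppSel p (gOfRecord₁₀ F N θ.toStage9Params p) (k + 1) a)
    (hnl : ∀ k, k < p.K → ∀ a, θ.ppSel p (gOfRecord₁₀ F N θ.toStage9Params p) (k + 1) a ≠ a →
      ¬ ∃ V, slotsTOfRecord F N θ.ν θ.τ9 (EOfRecord₁₀ F N θ.toStage9Params) (wOfRecord₉ F N θ.toStage9Params) θ.ppSel p
          (gOfRecord₁₀ F N θ.toStage9Params p) (k + 1) a V ≠ 0 ∧
        B15.BasicStep.fibreIntegral (fibOfSeq F θ.ν θ.τ9 p (gOfRecord₁₀ F N θ.toStage9Params p) (k + 1) a)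
          (rterm (sliceOfRecord F N θ.ν θ.τ9.M p (gOfRecord₁₀ F N θ.toStage9Params p) (k + 1)
            (slotsTOfRecord F N θ.ν θ.τ9 (EOfRecord₁₀ F N θ.toStage9Params) (wOfRecord₉ F N θ.toStage9Params) θ.ppSel p
              (gOfRecord₁₀ F N θ.toStage9Params p) (k + 1))) a) V ≠ 0)
    (hT : ∀ k, k < p.K → SLaw₁₂ F N θ p k → TLaw₁₂ F N θ p k) :
    ∀ k, k ≤ p.K → SLaw₁₂ F N θ p k :=
  sLaw₁₂_all_of_thmP245_of_idem_of_dead F N θ p h hθ hκ hE₀ hB₀ hg hidem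
    (fun k hk a hne => fibreIntegral_termT₁₂_eq_zero_of_not_live F N θ p k a (hnl k hk a hne)) hT

variable (w : WorldP) (h : θ.Provisos₁₂ F N)

/-- **Theorem 1's conclusion `densitiesDescribed` AT A STAGE-12 WORLD FROM (S1ᵀ) ALONE, live-selector branch**: at `w.C = (datumOfRecord₁₂ F N θ h).C`, the Theorem of
p. 245 at the objects of record (+ signs, non-negative history) gives `(leavesP w p).densitiesDescribed` — this seat's `densitiesDescribed_at_record₁₂_of_rOpLeaf` with
the leaf SUPPLIED by §2. [cite: Balaban1988Convergent, Thm 1 p.262; Theorem p.245; p.244] -/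
theorem densitiesDescribed_at_record₁₂_of_idem_of_dead (hC : w.C = (datumOfRecord₁₂ F N θ h).C) (hθ : θ.Admissible F N) (hκ : 0 ≤ θ.s2.lf.κ)
    (hE₀ : 0 ≤ θ.s2.lf.E₀) (hB₀ : 0 ≤ θ.s2.lf.B₀) (hg : ∀ k, k < p.K → 0 ≤ gOfRecord₁₀ F N θ.toStage9Params p (k + 1))
    (hidem : ∀ k, k < p.K → ∀ a, θ.ppSel p (gOfRecord₁₀ F N θ.toStage9Params p) (k + 1)
      (θ.ppSel p (gOfRecord₁₀ F N θ.toStage9Params p) (k + 1) a) = θ.ppSel p (gOfRecord₁₀ F N θ.toStage9Params p) (k + 1) a)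
    (hdead : ∀ k, k < p.K → ∀ a, θ.ppSel p (gOfRecord₁₀ F N θ.toStage9Params p) (k + 1) a ≠ a →
      ∀ V, B15.BasicStep.fibreIntegral (fibOfSeq F θ.ν θ.τ9 p (gOfRecord₁₀ F N θ.toStage9Params p) (k + 1) a)
        (rterm (sliceOfRecord F N θ.ν θ.τ9.M p (gOfRecord₁₀ F N θ.toStage9Params p) (k + 1)
          (slotsTOfRecord F N θ.ν θ.τ9 (EOfRecord₁₀ F N θ.toStage9Params) (wOfRecord₉ F N θ.toStage9Params) θ.ppSel p
            (gOfRecord₁₀ F N θ.toStage9Params p) (k + 1))) a) V = 0)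
    (hT : ∀ k, k < p.K → SLaw₁₂ F N θ p k → TLaw₁₂ F N θ p k) :
    (leavesP w p).densitiesDescribed :=
  densitiesDescribed_at_record₁₂_of_rOpLeaf F N θ p w h hC (rOpLeaf_VOfRecord₁₂_of_idem_of_dead F N θ p h hθ hκ hE₀ hB₀ hg hidem hdead) hT

/-- **N11 · `Dag.B14_main (leavesP w P)` AT A STAGE-12 WORLD ON THE LIVE-SELECTOR BRANCH — ONE DISPLAYED SLOT, NO 𝐑-READING HYPOTHESIS** ([Balaban1988Convergent]
Thm 1 p. 262 with the Theorem of p. 245 at NODE 00's Stage-12 objects of record).  Pin `hC`: the world is bound to the datum of record.  Slot (S1ᵀ) `hT`, displayed and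
printed: the Theorem of p. 245 at the objects of record GIVEN the node's in-edges `b7 … b11`, the interval hypothesis, the small-field inductive assumptions and the flow
control (2.6).  The START is node00-def-T's theorem `sLaw₁₂_zero`; the (𝐑) step is §2's THEOREM on this branch — the sign `0 ≤ g_{k+1}` it needs is READ FROM THE
NODE'S OWN INTERVAL ANTECEDENT `smallCouplings`; the node's `rOperation` antecedent is REDUNDANT here (received, not used).  Count-neutral slot landing.
[cite: Balaban1988Convergent, Thm 1 p.262; Theorem p.245; p.244; (2.6) p.255] -/
theorem b14_main_at_record₁₂_of_idem_of_dead (hC : w.C = (datumOfRecord₁₂ F N θ h).C) (hθ : θ.Admissible F N) (hκ : 0 ≤ θ.s2.lf.κ)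
    (hE₀ : 0 ≤ θ.s2.lf.E₀) (hB₀ : 0 ≤ θ.s2.lf.B₀)
    (hidem : ∀ k, k < p.K → ∀ a, θ.ppSel p (gOfRecord₁₀ F N θ.toStage9Params p) (k + 1)
      (θ.ppSel p (gOfRecord₁₀ F N θ.toStage9Params p) (k + 1) a) = θ.ppSel p (gOfRecord₁₀ F N θ.toStage9Params p) (k + 1) a)
    (hdead : ∀ k, k < p.K → ∀ a, θ.ppSel p (gOfRecord₁₀ F N θ.toStage9Params p) (k + 1) a ≠ a →
      ∀ V, B15.BasicStep.fibreIntegral (fibOfSeq F θ.ν θ.τ9 p (gOfRecord₁₀ F N θ.toStage9Params p) (k + 1) a)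
        (rterm (sliceOfRecord F N θ.ν θ.τ9.M p (gOfRecord₁₀ F N θ.toStage9Params p) (k + 1)
          (slotsTOfRecord F N θ.ν θ.τ9 (EOfRecord₁₀ F N θ.toStage9Params) (wOfRecord₉ F N θ.toStage9Params) θ.ppSel p
            (gOfRecord₁₀ F N θ.toStage9Params p) (k + 1))) a) V = 0)
    (hT : (leavesP w p).b7 → (leavesP w p).b8 → (leavesP w p).b9 → (leavesP w p).b10 → (leavesP w p).b11 →
      (leavesP w p).smallCouplings → (leavesP w p).smallFieldInductive → (leavesP w p).flowControl →
        ∀ k, k < p.K → SLaw₁₂ F N θ p k → TLaw₁₂ F N θ p k) :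
    Dag.B14_main (leavesP w p) := by
  intro h7 h8 h9 h10 h11 hsf hfc _ hsc
  have hg : ∀ k, k < p.K → 0 ≤ gOfRecord₁₀ F N θ.toStage9Params p (k + 1) := fun k hk => by
    have hgk : 0 < (w.C p).flow.g (k + 1) := (hsc (k + 1) hk).1
    rw [hC, flow_g_datumOfRecord₁₂] at hgk
    exact hgk.le
  exact densitiesDescribed_at_record₁₂_of_rOpLeaf F N θ p w h hC
    (rOpLeaf_VOfRecord₁₂_of_idem_of_dead F N θ p h hθ hκ hE₀ hB₀ hg hidem hdead) (hT h7 h8 h9 h10 h11 hsc (hsf hsc) (hfc hsc))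

/-- **N11 · `Dag.B14_main (leavesP w P)` AT A STAGE-12 WORLD, non-live currency** (idempotent selectors whose moved sequences are not live; no 𝐑-reading hypothesis).
[cite: Balaban1988Convergent, Thm 1 p.262; Theorem p.245; p.244; (2.6) p.255] -/
theorem b14_main_at_record₁₂_of_idem_of_notLive (hC : w.C = (datumOfRecord₁₂ F N θ h).C) (hθ : θ.Admissible F N) (hκ : 0 ≤ θ.s2.lf.κ)
    (hE₀ : 0 ≤ θ.s2.lf.E₀) (hB₀ : 0 ≤ θ.s2.lf.B₀)
    (hidem : ∀ k, k < p.K → ∀ a, θ.ppSel p (gOfRecord₁₀ F N θ.toStage9Params p) (k + 1)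
      (θ.ppSel p (gOfRecord₁₀ F N θ.toStage9Params p) (k + 1) a) = θ.ppSel p (gOfRecord₁₀ F N θ.toStage9Params p) (k + 1) a)
    (hnl : ∀ k, k < p.K → ∀ a, θ.ppSel p (gOfRecord₁₀ F N θ.toStage9Params p) (k + 1) a ≠ a →
      ¬ ∃ V, slotsTOfRecord F N θ.ν θ.τ9 (EOfRecord₁₀ F N θ.toStage9Params) (wOfRecord₉ F N θ.toStage9Params) θ.ppSel p
          (gOfRecord₁₀ F N θ.toStage9Params p) (k + 1) a V ≠ 0 ∧
        B15.BasicStep.fibreIntegral (fibOfSeq F θ.ν θ.τ9 p (gOfRecord₁₀ F N θ.toStage9Params p) (k + 1) a)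
          (rterm (sliceOfRecord F N θ.ν θ.τ9.M p (gOfRecord₁₀ F N θ.toStage9Params p) (k + 1)
            (slotsTOfRecord F N θ.ν θ.τ9 (EOfRecord₁₀ F N θ.toStage9Params) (wOfRecord₉ F N θ.toStage9Params) θ.ppSel p
              (gOfRecord₁₀ F N θ.toStage9Params p) (k + 1))) a) V ≠ 0)
    (hT : (leavesP w p).b7 → (leavesP w p).b8 → (leavesP w p).b9 → (leavesP w p).b10 → (leavesP w p).b11 →
      (leavesP w p).smallCouplings → (leavesP w p).smallFieldInductive → (leavesP w p).flowControl →
        ∀ k, k < p.K → SLaw₁₂ F N θ p k → TLaw₁₂ F N θ p k) :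
    Dag.B14_main (leavesP w p) :=
  b14_main_at_record₁₂_of_idem_of_dead F N θ p w h hC hθ hκ hE₀ hB₀ hidem
    (fun k hk a hne => fibreIntegral_termT₁₂_eq_zero_of_not_live F N θ p k a (hnl k hk a hne)) hT

/-- **N11 IN THE BINDER SHAPE OF THE ROUTE's K1′ STUB `stub_nodes12`** (a world `w` with `IsRecordOfRecord₁₂C F N (datumOfRecord₁₂ F N θ h) w` at an EXPLICIT `(θ, h)`):
on the live-selector branch the N11 conjunct `Dag.B14_main (leavesP w P)` of `DagBinding.Nodes (leavesP w P)` holds at every run from the slot (S1ᵀ) at `θ`'s objects of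
record alone (+ the displayed signs) — `construction_eq_of_isRecordOfRecord₁₂C` feeds `hC`.  For a K1′ prover choosing a witness on this branch, N11's share of the stub
IS (S1ᵀ). [cite: Balaban1988Convergent, Thm 1 p.262; Theorem p.245; p.244 (bookkeeping at the record)] -/
theorem b14_main_of_isRecordOfRecord₁₂C_datum_of_idem_of_dead (hrec : IsRecordOfRecord₁₂C F N (datumOfRecord₁₂ F N θ h) w)
    (hθ : θ.Admissible F N) (hκ : 0 ≤ θ.s2.lf.κ) (hE₀ : 0 ≤ θ.s2.lf.E₀) (hB₀ : 0 ≤ θ.s2.lf.B₀)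
    (hidem : ∀ (P : B12.RunParams) (k : ℕ), k < P.K → ∀ a, θ.ppSel P (gOfRecord₁₀ F N θ.toStage9Params P) (k + 1)
      (θ.ppSel P (gOfRecord₁₀ F N θ.toStage9Params P) (k + 1) a) = θ.ppSel P (gOfRecord₁₀ F N θ.toStage9Params P) (k + 1) a)
    (hdead : ∀ (P : B12.RunParams) (k : ℕ), k < P.K → ∀ a, θ.ppSel P (gOfRecord₁₀ F N θ.toStage9Params P) (k + 1) a ≠ a →
      ∀ V, B15.BasicStep.fibreIntegral (fibOfSeq F θ.ν θ.τ9 P (gOfRecord₁₀ F N θ.toStage9Params P) (k + 1) a)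
        (rterm (sliceOfRecord F N θ.ν θ.τ9.M P (gOfRecord₁₀ F N θ.toStage9Params P) (k + 1)
          (slotsTOfRecord F N θ.ν θ.τ9 (EOfRecord₁₀ F N θ.toStage9Params) (wOfRecord₉ F N θ.toStage9Params) θ.ppSel P
            (gOfRecord₁₀ F N θ.toStage9Params P) (k + 1))) a) V = 0)
    (hT : ∀ P : B12.RunParams, (leavesP w P).b7 → (leavesP w P).b8 → (leavesP w P).b9 → (leavesP w P).b10 → (leavesP w P).b11 →
      (leavesP w P).smallCouplings → (leavesP w P).smallFieldInductive → (leavesP w P).flowControl →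
        ∀ k, k < P.K → SLaw₁₂ F N θ P k → TLaw₁₂ F N θ P k) (P : B12.RunParams) :
    Dag.B14_main (leavesP w P) :=
  b14_main_at_record₁₂_of_idem_of_dead F N θ P w h (construction_eq_of_isRecordOfRecord₁₂C hrec) hθ hκ hE₀ hB₀ (hidem P) (hdead P) (hT P)

/-- **N11 in the K1′ `stub_nodes12` binder shape, non-live currency.** [cite: Balaban1988Convergent, Thm 1 p.262; Theorem p.245; p.244 (bookkeeping at the record)] -/
theorem b14_main_of_isRecordOfRecord₁₂C_datum_of_idem_of_notLive (hrec : IsRecordOfRecord₁₂C F N (datumOfRecord₁₂ F N θ h) w)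
    (hθ : θ.Admissible F N) (hκ : 0 ≤ θ.s2.lf.κ) (hE₀ : 0 ≤ θ.s2.lf.E₀) (hB₀ : 0 ≤ θ.s2.lf.B₀)
    (hidem : ∀ (P : B12.RunParams) (k : ℕ), k < P.K → ∀ a, θ.ppSel P (gOfRecord₁₀ F N θ.toStage9Params P) (k + 1)
      (θ.ppSel P (gOfRecord₁₀ F N θ.toStage9Params P) (k + 1) a) = θ.ppSel P (gOfRecord₁₀ F N θ.toStage9Params P) (k + 1) a)
    (hnl : ∀ (P : B12.RunParams) (k : ℕ), k < P.K → ∀ a, θ.ppSel P (gOfRecord₁₀ F N θ.toStage9Params P) (k + 1) a ≠ a →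
      ¬ ∃ V, slotsTOfRecord F N θ.ν θ.τ9 (EOfRecord₁₀ F N θ.toStage9Params) (wOfRecord₉ F N θ.toStage9Params) θ.ppSel P
          (gOfRecord₁₀ F N θ.toStage9Params P) (k + 1) a V ≠ 0 ∧
        B15.BasicStep.fibreIntegral (fibOfSeq F θ.ν θ.τ9 P (gOfRecord₁₀ F N θ.toStage9Params P) (k + 1) a)
          (rterm (sliceOfRecord F N θ.ν θ.τ9.M P (gOfRecord₁₀ F N θ.toStage9Params P) (k + 1)
            (slotsTOfRecord F N θ.ν θ.τ9 (EOfRecord₁₀ F N θ.toStage9Params) (wOfRecord₉ F N θ.toStage9Params) θ.ppSel P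
              (gOfRecord₁₀ F N θ.toStage9Params P) (k + 1))) a) V ≠ 0)
    (hT : ∀ P : B12.RunParams, (leavesP w P).b7 → (leavesP w P).b8 → (leavesP w P).b9 → (leavesP w P).b10 → (leavesP w P).b11 →
      (leavesP w P).smallCouplings → (leavesP w P).smallFieldInductive → (leavesP w P).flowControl →
        ∀ k, k < P.K → SLaw₁₂ F N θ P k → TLaw₁₂ F N θ P k) (P : B12.RunParams) :
    Dag.B14_main (leavesP w P) :=
  b14_main_of_isRecordOfRecord₁₂C_datum_of_idem_of_dead F N θ w h hrec hθ hκ hE₀ hB₀ hidem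
    (fun P k hk a hne => fibreIntegral_termT₁₂_eq_zero_of_not_live F N θ P k a (hnl P k hk a hne)) hT P

/-- **★ THE ROUTE's K1′ (B)-FACE FIRST CONJUNCT `B16.Thm1Printed (datumOfRecord₁₂ F N θ h).C` FROM THE THEOREM OF p. 245 ALONG THE WINDOWED RUNS ALONE, ON THE
LIVE-SELECTOR BRANCH** ([Balaban1989LargeFieldII] Thm 1 p. 355 = [Balaban1988Convergent] Thm 1 p. 262 as the tree states it over the datum's `Sect2Data`): along every run
whose flow stays in `]0, γ]` (`0 < γ`) and whose positive-level selectors are idempotent and move only dead sequences, N11's slot (S1ᵀ) in law currency (`hT`) gives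
Theorem 1 at the datum — this seat's `thm1Printed_datumOfRecord₁₂_of_laws_rAssumedP244` with the p. 244 hypothesis SUPPLIED by §2 (`0 ≤ g` from the window).  Both
remaining hypotheses displayed; nothing of Sects. 1–3 asserted. [cite: Balaban1989LargeFieldII, Thm 1 p.355; Balaban1988Convergent, Thm 1 p.262; Theorem p.245; p.244] -/
theorem thm1Printed_datumOfRecord₁₂_of_laws_of_idem_of_dead (hθ : θ.Admissible F N) (hκ : 0 ≤ θ.s2.lf.κ) (hE₀ : 0 ≤ θ.s2.lf.E₀)
    (hB₀ : 0 ≤ θ.s2.lf.B₀) {γ : ℝ} (hγ : 0 < γ)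
    (hidem : ∀ P : B12.RunParams, ((datumOfRecord₁₂ F N θ h).C P).flow.InInterval γ P.K →
      ∀ k, k < P.K → ∀ a, θ.ppSel P (gOfRecord₁₀ F N θ.toStage9Params P) (k + 1)
      (θ.ppSel P (gOfRecord₁₀ F N θ.toStage9Params P) (k + 1) a) = θ.ppSel P (gOfRecord₁₀ F N θ.toStage9Params P) (k + 1) a)
    (hdead : ∀ P : B12.RunParams, ((datumOfRecord₁₂ F N θ h).C P).flow.InInterval γ P.K →
      ∀ k, k < P.K → ∀ a, θ.ppSel P (gOfRecord₁₀ F N θ.toStage9Params P) (k + 1) a ≠ a →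
      ∀ V, B15.BasicStep.fibreIntegral (fibOfSeq F θ.ν θ.τ9 P (gOfRecord₁₀ F N θ.toStage9Params P) (k + 1) a)
        (rterm (sliceOfRecord F N θ.ν θ.τ9.M P (gOfRecord₁₀ F N θ.toStage9Params P) (k + 1)
          (slotsTOfRecord F N θ.ν θ.τ9 (EOfRecord₁₀ F N θ.toStage9Params) (wOfRecord₉ F N θ.toStage9Params) θ.ppSel P
            (gOfRecord₁₀ F N θ.toStage9Params P) (k + 1))) a) V = 0)
    (hT : ∀ P : B12.RunParams, ((datumOfRecord₁₂ F N θ h).C P).flow.InInterval γ P.K →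
      ∀ k, k < P.K → SLaw₁₂ F N θ P k → TLaw₁₂ F N θ P k) :
    B16.Thm1Printed (datumOfRecord₁₂ F N θ h).C :=
  thm1Printed_datumOfRecord₁₂_of_laws_rAssumedP244 F N θ h hγ hT
    (fun P hP => (rOpLeaf₁₂_iff_rAssumedP244 F N θ P).1
      (rOpLeaf_VOfRecord₁₂_of_idem_of_dead_of_inInterval F N θ P h hθ hκ hE₀ hB₀ hP (hidem P hP) (hdead P hP)))

/-- **The (B)-face's first conjunct from the Theorem of p. 245 along the windowed runs alone, non-live currency** (the live selector by construction).
[cite: Balaban1989LargeFieldII, Thm 1 p.355; Balaban1988Convergent, Thm 1 p.262; Theorem p.245; p.244] -/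
theorem thm1Printed_datumOfRecord₁₂_of_laws_of_idem_of_notLive (hθ : θ.Admissible F N) (hκ : 0 ≤ θ.s2.lf.κ) (hE₀ : 0 ≤ θ.s2.lf.E₀)
    (hB₀ : 0 ≤ θ.s2.lf.B₀) {γ : ℝ} (hγ : 0 < γ)
    (hidem : ∀ P : B12.RunParams, ((datumOfRecord₁₂ F N θ h).C P).flow.InInterval γ P.K →
      ∀ k, k < P.K → ∀ a, θ.ppSel P (gOfRecord₁₀ F N θ.toStage9Params P) (k + 1)
      (θ.ppSel P (gOfRecord₁₀ F N θ.toStage9Params P) (k + 1) a) = θ.ppSel P (gOfRecord₁₀ F N θ.toStage9Params P) (k + 1) a)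
    (hnl : ∀ P : B12.RunParams, ((datumOfRecord₁₂ F N θ h).C P).flow.InInterval γ P.K →
      ∀ k, k < P.K → ∀ a, θ.ppSel P (gOfRecord₁₀ F N θ.toStage9Params P) (k + 1) a ≠ a →
      ¬ ∃ V, slotsTOfRecord F N θ.ν θ.τ9 (EOfRecord₁₀ F N θ.toStage9Params) (wOfRecord₉ F N θ.toStage9Params) θ.ppSel P
          (gOfRecord₁₀ F N θ.toStage9Params P) (k + 1) a V ≠ 0 ∧
        B15.BasicStep.fibreIntegral (fibOfSeq F θ.ν θ.τ9 P (gOfRecord₁₀ F N θ.toStage9Params P) (k + 1) a)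
          (rterm (sliceOfRecord F N θ.ν θ.τ9.M P (gOfRecord₁₀ F N θ.toStage9Params P) (k + 1)
            (slotsTOfRecord F N θ.ν θ.τ9 (EOfRecord₁₀ F N θ.toStage9Params) (wOfRecord₉ F N θ.toStage9Params) θ.ppSel P
              (gOfRecord₁₀ F N θ.toStage9Params P) (k + 1))) a) V ≠ 0)
    (hT : ∀ P : B12.RunParams, ((datumOfRecord₁₂ F N θ h).C P).flow.InInterval γ P.K →
      ∀ k, k < P.K → SLaw₁₂ F N θ P k → TLaw₁₂ F N θ P k) :
    B16.Thm1Printed (datumOfRecord₁₂ F N θ h).C :=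
  thm1Printed_datumOfRecord₁₂_of_laws_of_idem_of_dead F N θ h hθ hκ hE₀ hB₀ hγ hidem
    (fun P hP k hk a hne => fibreIntegral_termT₁₂_eq_zero_of_not_live F N θ P k a (hnl P hP k hk a hne)) hT

/-- **`B16.Thm1Printed` AT THE STAGE-12 DATUM FROM [III]'s THEOREM OF p. 245 IN [III]'s OWN NAME, live-selector branch** — `B14.ThmP245PrintedI` (sequence reading, for
any `T`-family agreeing with the tower on the trajectory of each windowed run; this seat's dictionary `thmP245PrintedI_at_record₁₂_iff_laws`): the director's row
«`ThmP245Printed` via `rOperation` from N13's `ROpLeaf`» with N13's leaf a THEOREM of the branch (§2) — so the (B)-face's first conjunct rests on [III]'s Theorem of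
p. 245 ALONE.  Dictionary-level in `T`; load-bearing: `hT`'s law reading. [cite: Balaban1988Convergent, Theorem p.245, Thm 1 p.262; Balaban1989LargeFieldII, Thm 1 p.355] -/
theorem thm1Printed_datumOfRecord₁₂_of_thmP245I_of_idem_of_dead (hθ : θ.Admissible F N) (hκ : 0 ≤ θ.s2.lf.κ) (hE₀ : 0 ≤ θ.s2.lf.E₀)
    (hB₀ : 0 ≤ θ.s2.lf.B₀) {γ : ℝ} (hγ : 0 < γ)
    (hidem : ∀ P : B12.RunParams, ((datumOfRecord₁₂ F N θ h).C P).flow.InInterval γ P.K →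
      ∀ k, k < P.K → ∀ a, θ.ppSel P (gOfRecord₁₀ F N θ.toStage9Params P) (k + 1)
      (θ.ppSel P (gOfRecord₁₀ F N θ.toStage9Params P) (k + 1) a) = θ.ppSel P (gOfRecord₁₀ F N θ.toStage9Params P) (k + 1) a)
    (hdead : ∀ P : B12.RunParams, ((datumOfRecord₁₂ F N θ h).C P).flow.InInterval γ P.K →
      ∀ k, k < P.K → ∀ a, θ.ppSel P (gOfRecord₁₀ F N θ.toStage9Params P) (k + 1) a ≠ a →
      ∀ V, B15.BasicStep.fibreIntegral (fibOfSeq F θ.ν θ.τ9 P (gOfRecord₁₀ F N θ.toStage9Params P) (k + 1) a)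
        (rterm (sliceOfRecord F N θ.ν θ.τ9.M P (gOfRecord₁₀ F N θ.toStage9Params P) (k + 1)
          (slotsTOfRecord F N θ.ν θ.τ9 (EOfRecord₁₀ F N θ.toStage9Params) (wOfRecord₉ F N θ.toStage9Params) θ.ppSel P
            (gOfRecord₁₀ F N θ.toStage9Params P) (k + 1))) a) V = 0)
    (T : (P : B12.RunParams) → (k : ℕ) → RTOpI (F.P P.K) k (SU N) (avOfRecord F N P.K k))
    (hTT : ∀ (P : B12.RunParams) (k : ℕ), k < P.K →
      (T P k).T (densOfRecord₁₀ F N θ.toStage9Params P k) = tdensOfRecord₁₀ F N θ.toStage9Params P k)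
    (hT : ∀ P : B12.RunParams, ((datumOfRecord₁₂ F N θ h).C P).flow.InInterval γ P.K →
      B14.ThmP245PrintedI (T P) (densOfRecord₁₀ F N θ.toStage9Params P) (VOfRecord₁₂ F N θ P).S (VOfRecord₁₂ F N θ P).Scorr P.K) :
    B16.Thm1Printed (datumOfRecord₁₂ F N θ h).C :=
  thm1Printed_datumOfRecord₁₂_of_laws_of_idem_of_dead F N θ h hθ hκ hE₀ hB₀ hγ hidem hdead
    (fun P hP => (thmP245PrintedI_at_record₁₂_iff_laws F N θ P (T P) (hTT P)).1 (hT P hP))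

end Junction

/-! ## §4  (v1.1) ★ 𝐑 OF RECORD IS THE IDENTITY ALMOST EVERYWHERE ON THE LIVE-SELECTOR BRANCH: `(𝐑ρ) = ρ` a.e. (generic), `ρ_{k+1} = 𝐓ρ_k` a.e. (Stage 12) -/

section IdentityAE

variable {P : Params} {G : Type*} [GaugeGroup G] [MeasurableSpace G] [HaarData G] {j : ℕ}

/-- **An idempotent self-map moves exactly the points OFF its range** (the shape of print's `Z ↦ Z″`, `Z″″ = Z″`): `sel a ≠ a ⇒ a ∉ range sel`.
[cite: Balaban1989LargeFieldI, (0.3) p.176, p.177 (bookkeeping)] -/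
theorem not_mem_range_of_idem_of_ne {α : Type*} {sel : α → α} (hidem : ∀ a, sel (sel a) = sel a) {a : α} (hne : sel a ≠ a) :
    a ∉ Set.range sel := fun ⟨b, hb⟩ => hne (by rw [← hb]; exact hidem b)

/-- **A DEAD TERM IS ZERO ALMOST EVERYWHERE** under the (0.3) provisos on it (measurable, `0 ≤ t ≤ C`): if every restricted integral `∫⌈_{Z′} t (V)` vanishes then
`∫ t dV = 0` — node00-def-K0b's Fubini-over-a-fibre lemma `exists_ne_zero_and_fibreIntegral_ne_zero` («`∫ t ≠ 0` ⇒ some field with `t ≠ 0` and `∫⌈_{Z′} t ≠ 0`») read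
contrapositively — hence `t = 0` a.e. (`integral_eq_zero_iff_of_nonneg`; the field measure is a probability measure).  The `DecidableEq (PBond …)` instance is an
implicit binder. [cite: Balaban1989LargeFieldI, (0.3)–(0.4) p.176] -/
theorem ae_eq_zero_of_dead {hP : DecidableEq (PBond P j)} (s : Finset (PBond P j)) {t : Density P j G}
    (hm : Measurable t) (h0 : ∀ V, 0 ≤ t V) {C : ℝ} (hC : ∀ V, t V ≤ C)
    (hdead : ∀ V, B15.BasicStep.fibreIntegral s t V = 0) :
    t =ᵐ[fieldMeasure P j G] 0 := by
  haveI : IsProbabilityMeasure (fieldMeasure P j G) := Missing.isProbabilityMeasure_fieldMeasure P j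
  have hint : Integrable t (fieldMeasure P j G) :=
    Integrable.of_mem_Icc 0 C hm.aemeasurable (Filter.Eventually.of_forall fun V => ⟨h0 V, hC V⟩)
  have hz : ∫ V, t V ∂(fieldMeasure P j G) = 0 := by
    by_contra hne
    obtain ⟨V, -, hV⟩ := exists_ne_zero_and_fibreIntegral_ne_zero (hD := hP) s hm h0 hC hne
    exact hV (hdead V)
  exact (integral_eq_zero_iff_of_nonneg (fun V => h0 V) hint).1 hz

/-- **★ EVERY SUMMAND OF (0.3) RE-INDEXED BY `Z″` AGREES A.E. WITH THE CORRESPONDING SUMMAND OF (2.18), for an idempotent selector moving only dead sequences**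
(generic over def-R's `rstepOfSel`, under the support-form provisos of p. 176 on the datum `repDataOfSel r sel fib`): `χ(a)·(𝐓e^A)′(a) = χ(a)·(𝐓e^A)(a) = t_a`
a.e. — at a FIXED POINT even pointwise (§1 `rstepOfSel_TexpA_of_fix_of_dead` on the `χ(a)`-support, `0 = 0` off it); at a MOVED sequence the left side is `0`
pointwise (off the range of an idempotent selector: n13-c's `rstepOfSel_TexpA_of_not_mem_range`) and the right side is `0` a.e. (`ae_eq_zero_of_dead`).
[cite: Balaban1989LargeFieldI, (0.2)–(0.3) p.176, p.177 (i)–(ii); Balaban1988Convergent, (2.18) p.257] -/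
theorem chi_mul_rstepOfSel_TexpA_ae_eq_rterm_of_idem_of_dead {hP : DecidableEq (PBond P j)} (r : Step.Repr218 P G j) (sel : r.Adm → r.Adm)
    (fib : r.Adm → Finset (PBond P j)) (hprov : (repDataOfSel r sel fib).ProvisosSupp) (hidem : ∀ a, sel (sel a) = sel a)
    (hdead : ∀ a, sel a ≠ a → ∀ V, B15.BasicStep.fibreIntegral (fib a) (rterm r a) V = 0) (a : r.Adm) :
    (fun V => r.χ a V * (rstepOfSel r sel fib).TexpA a V) =ᵐ[fieldMeasure P j G] rterm r a := by
  obtain ⟨hm, h0, ⟨C, hC⟩, hsupp⟩ := hprov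
  by_cases hfix : sel a = a
  · refine Filter.Eventually.of_forall fun V => ?_
    show r.χ a V * (rstepOfSel r sel fib).TexpA a V = r.χ a V * r.TexpA a V
    by_cases hχ : r.χ a V = 0
    · rw [hχ, zero_mul, zero_mul]
    · have hsupp' : B15.BasicStep.fibreIntegral (fib a) (rterm r a) V = 0 → rterm r a V = 0 := by
        have H := hsupp a V
        change B15.BasicStep.fibreIntegral (fib a) (rterm r (sel a)) V = 0 → rterm r a V = 0 at H
        rw [hfix] at H
        exact H
      rw [rstepOfSel_TexpA_of_fix_of_dead r sel fib a hfix
        (fun b hb hne => hdead b fun heq => hne (heq.symm.trans hb)) V hsupp' hχ]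
  · have hnr : a ∉ Set.range sel := not_mem_range_of_idem_of_ne hidem hfix
    have hL : (fun V => r.χ a V * (rstepOfSel r sel fib).TexpA a V) = fun _ => 0 :=
      funext fun V => by rw [rstepOfSel_TexpA_of_not_mem_range r sel fib a hnr V, mul_zero]
    rw [hL]
    have hm' : Measurable (rterm r a) := hm a
    have h0' : ∀ V, 0 ≤ rterm r a V := fun V => h0 a V
    have hC' : ∀ V, rterm r a V ≤ C := fun V => hC a V
    exact (ae_eq_zero_of_dead (fib a) hm' h0' hC' (hdead a hfix)).symm

/-- **★ (𝐑ρ) = ρ ALMOST EVERYWHERE for an idempotent selector moving only dead sequences** (generic; the sum of the previous lemma over the finitely many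
sequences): `Σ_{a} χ(a)·(𝐓e^A)′(a) = Σ_a χ(a)·(𝐓e^A)(a)` a.e. — (0.3) re-indexed by `Z″` equals (2.18) a.e.; on this branch the operation 𝐑 changes the density
on a null set only. [cite: Balaban1989LargeFieldI, (0.2)–(0.4) p.176, p.177 (i)–(ii); Balaban1988Convergent, (2.18) p.257, Thm 1 p.262] -/
theorem sum_rstepOfSel_ae_eq_sum_of_idem_of_dead {hP : DecidableEq (PBond P j)} (r : Step.Repr218 P G j) (sel : r.Adm → r.Adm)
    (fib : r.Adm → Finset (PBond P j)) (hprov : (repDataOfSel r sel fib).ProvisosSupp) (hidem : ∀ a, sel (sel a) = sel a)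
    (hdead : ∀ a, sel a ≠ a → ∀ V, B15.BasicStep.fibreIntegral (fib a) (rterm r a) V = 0) :
    (fun V => ∑ a, r.χ a V * (rstepOfSel r sel fib).TexpA a V) =ᵐ[fieldMeasure P j G] fun V => ∑ a, r.χ a V * r.TexpA a V := by
  have hall : ∀ᵐ V ∂(fieldMeasure P j G), ∀ a, r.χ a V * (rstepOfSel r sel fib).TexpA a V = rterm r a V :=
    ae_all_iff.2 fun a => chi_mul_rstepOfSel_TexpA_ae_eq_rterm_of_idem_of_dead r sel fib hprov hidem hdead a
  filter_upwards [hall] with V hV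
  exact Finset.sum_congr rfl fun a _ => hV a

/-- **The same in def-R's ∕ b01's vocabulary**: the datum's (0.3) `RopReal (rterm r) sel fib` equals its (0.2) total `(repDataOfSel r sel fib).total` a.e.
(`sum_rstepOfSel_eq`, `repDataOfSel_total`). [cite: Balaban1989LargeFieldI, (0.2)–(0.3) p.176] -/
theorem ropReal_ae_eq_total_of_idem_of_dead {hP : DecidableEq (PBond P j)} (r : Step.Repr218 P G j) (sel : r.Adm → r.Adm)
    (fib : r.Adm → Finset (PBond P j)) (hprov : (repDataOfSel r sel fib).ProvisosSupp) (hidem : ∀ a, sel (sel a) = sel a)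
    (hdead : ∀ a, sel a ≠ a → ∀ V, B15.BasicStep.fibreIntegral (fib a) (rterm r a) V = 0) :
    B15.BasicStep.RopReal (rterm r) sel fib =ᵐ[fieldMeasure P j G] (repDataOfSel r sel fib).total := by
  filter_upwards [sum_rstepOfSel_ae_eq_sum_of_idem_of_dead r sel fib hprov hidem hdead] with V hV
  rw [← sum_rstepOfSel_eq r sel fib V, repDataOfSel_total]
  exact hV

end IdentityAE

section IdentityAERecord

variable (θ : Stage12Params F N) (p : B12.RunParams)

/-- **★ AT THE STAGE-12 RECORD, `ρ_{k+1} = 𝐓ρ_k` ALMOST EVERYWHERE ON THE LIVE-SELECTOR BRANCH** (`k < K`; `Provisos₁₂.base.rstep` = def-R's support-form (0.3)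
provisos of the pre-𝐑 tower; the level-`k+1` selector idempotent and moving only dead sequences): the density of record after the step, `densOfRecord₁₀ … (k+1) =
Σ_{s′} χ_{k+1}(s′)·slot_{k+1}(s′)`, and the 𝐓-stepped density `tdensOfRecord₁₀ … k = Σ_{s′} χ_{k+1}(s′)·slotT_{k+1}(s′)` agree a.e. — per sequence: fixed points
pointwise on the support (§1 `slotsOfRecord₁₂_succ_eq_slotsT_of_fix_of_dead`), moved sequences `0 = t_{s′}` a.e. (v1.0's `slotsOfRecord₁₂_succ_eq_zero_of_not_mem_range` +
`ae_eq_zero_of_dead`).  On this branch 𝐑 OF RECORD CHANGES NO DENSITY OF THE RUN BEYOND A NULL SET — the located meaning of «N13's 𝐑-half is a theorem here».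
[cite: Balaban1989LargeFieldI, (0.2)–(0.4) p.176, p.177 (i)–(ii); Balaban1988Convergent, (2.18) p.257, Thm 1 p.262, (3.24)–(3.25) p.270; Balaban1989LargeFieldII, Thm 1 p.355 (not exercised)] -/
theorem densOfRecord₁₂_succ_ae_eq_tdens_of_idem_of_dead (h : θ.Provisos₁₂ F N) (k : ℕ) (hk : k < p.K)
    (hidem : ∀ a, θ.ppSel p (gOfRecord₁₀ F N θ.toStage9Params p) (k + 1) (θ.ppSel p (gOfRecord₁₀ F N θ.toStage9Params p) (k + 1) a)
      = θ.ppSel p (gOfRecord₁₀ F N θ.toStage9Params p) (k + 1) a)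
    (hdead : ∀ a, θ.ppSel p (gOfRecord₁₀ F N θ.toStage9Params p) (k + 1) a ≠ a →
      ∀ V, B15.BasicStep.fibreIntegral (fibOfSeq F θ.ν θ.τ9 p (gOfRecord₁₀ F N θ.toStage9Params p) (k + 1) a)
        (rterm (sliceOfRecord F N θ.ν θ.τ9.M p (gOfRecord₁₀ F N θ.toStage9Params p) (k + 1)
          (slotsTOfRecord F N θ.ν θ.τ9 (EOfRecord₁₀ F N θ.toStage9Params) (wOfRecord₉ F N θ.toStage9Params) θ.ppSel p
            (gOfRecord₁₀ F N θ.toStage9Params p) (k + 1))) a) V = 0) :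
    densOfRecord₁₀ F N θ.toStage9Params p (k + 1) =ᵐ[fieldMeasure (F.P p.K) (k + 1) (SU N)] tdensOfRecord₁₀ F N θ.toStage9Params p k := by
  have HP := h.base.rstep p k hk
  have hs : ∀ s, ∀ᵐ V ∂(fieldMeasure (F.P p.K) (k + 1) (SU N)),
      chiSeqOfRecord F N θ.ν θ.τ9.M (gOfRecord₁₀ F N θ.toStage9Params p) p.K (k + 1) s V *
          slotsOfRecord F N θ.ν θ.τ9 (EOfRecord₁₀ F N θ.toStage9Params) (wOfRecord₉ F N θ.toStage9Params) θ.ppSel p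
        (gOfRecord₁₀ F N θ.toStage9Params p) (k + 1) s V
        = chiSeqOfRecord F N θ.ν θ.τ9.M (gOfRecord₁₀ F N θ.toStage9Params p) p.K (k + 1) s V *
          slotsTOfRecord F N θ.ν θ.τ9 (EOfRecord₁₀ F N θ.toStage9Params) (wOfRecord₉ F N θ.toStage9Params) θ.ppSel p
        (gOfRecord₁₀ F N θ.toStage9Params p) (k + 1) s V := by
    intro s
    by_cases hfix : θ.ppSel p (gOfRecord₁₀ F N θ.toStage9Params p) (k + 1) s = s
    · refine Filter.Eventually.of_forall fun V => ?_
      by_cases hχ : chiSeqOfRecord F N θ.ν θ.τ9.M (gOfRecord₁₀ F N θ.toStage9Params p) p.K (k + 1) s V = 0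
      · rw [hχ, zero_mul, zero_mul]
      · rw [slotsOfRecord₁₂_succ_eq_slotsT_of_fix_of_dead F N θ p h k hk s hfix
          (fun a ha hne => hdead a fun heq => hne (heq.symm.trans ha)) V hχ]
    · have hnr : s ∉ Set.range (θ.ppSel p (gOfRecord₁₀ F N θ.toStage9Params p) (k + 1)) := not_mem_range_of_idem_of_ne hidem hfix
      have hz := slotsOfRecord₁₂_succ_eq_zero_of_not_mem_range F N θ p k s hnr
      have hm : Measurable fun V => chiSeqOfRecord F N θ.ν θ.τ9.M (gOfRecord₁₀ F N θ.toStage9Params p) p.K (k + 1) s V *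
          slotsTOfRecord F N θ.ν θ.τ9 (EOfRecord₁₀ F N θ.toStage9Params) (wOfRecord₉ F N θ.toStage9Params) θ.ppSel p
        (gOfRecord₁₀ F N θ.toStage9Params p) (k + 1) s V := HP.1 s
      have h0 : ∀ V, 0 ≤ chiSeqOfRecord F N θ.ν θ.τ9.M (gOfRecord₁₀ F N θ.toStage9Params p) p.K (k + 1) s V *
          slotsTOfRecord F N θ.ν θ.τ9 (EOfRecord₁₀ F N θ.toStage9Params) (wOfRecord₉ F N θ.toStage9Params) θ.ppSel p
        (gOfRecord₁₀ F N θ.toStage9Params p) (k + 1) s V := fun V => HP.2.1 s V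
      obtain ⟨C, hC⟩ := HP.2.2.1
      have hC' : ∀ V, chiSeqOfRecord F N θ.ν θ.τ9.M (gOfRecord₁₀ F N θ.toStage9Params p) p.K (k + 1) s V *
          slotsTOfRecord F N θ.ν θ.τ9 (EOfRecord₁₀ F N θ.toStage9Params) (wOfRecord₉ F N θ.toStage9Params) θ.ppSel p
        (gOfRecord₁₀ F N θ.toStage9Params p) (k + 1) s V ≤ C := fun V => hC s V
      have hae := ae_eq_zero_of_dead (fibOfSeq F θ.ν θ.τ9 p (gOfRecord₁₀ F N θ.toStage9Params p) (k + 1) s) hm h0 hC'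
        (fun V => hdead s hfix V)
      filter_upwards [hae] with V hV
      have hV' : chiSeqOfRecord F N θ.ν θ.τ9.M (gOfRecord₁₀ F N θ.toStage9Params p) p.K (k + 1) s V *
          slotsTOfRecord F N θ.ν θ.τ9 (EOfRecord₁₀ F N θ.toStage9Params) (wOfRecord₉ F N θ.toStage9Params) θ.ppSel p
        (gOfRecord₁₀ F N θ.toStage9Params p) (k + 1) s V = 0 := hV
      rw [hz, Pi.zero_apply, mul_zero, hV']
  have hall := ae_all_iff.2 hs
  filter_upwards [hall] with V hV
  exact Finset.sum_congr rfl fun s _ => hV s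

/-- **`ρ_{k+1} = 𝐓ρ_k` a.e. at the Stage-12 record, non-live currency** (the level-`k+1` selector idempotent, its moved sequences not live — node00-def-K0a's live selector
by construction; hypothesis = the negated body of `LiveSeq` at the pre-𝐑 family). [cite: Balaban1989LargeFieldI, (0.2)–(0.4) p.176, p.177 (i)–(ii); Balaban1988Convergent, Thm 1 p.262, (3.24)–(3.25) p.270] -/
theorem densOfRecord₁₂_succ_ae_eq_tdens_of_idem_of_notLive (h : θ.Provisos₁₂ F N) (k : ℕ) (hk : k < p.K)
    (hidem : ∀ a, θ.ppSel p (gOfRecord₁₀ F N θ.toStage9Params p) (k + 1) (θ.ppSel p (gOfRecord₁₀ F N θ.toStage9Params p) (k + 1) a)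
      = θ.ppSel p (gOfRecord₁₀ F N θ.toStage9Params p) (k + 1) a)
    (hnl : ∀ a, θ.ppSel p (gOfRecord₁₀ F N θ.toStage9Params p) (k + 1) a ≠ a →
      ¬ ∃ V, slotsTOfRecord F N θ.ν θ.τ9 (EOfRecord₁₀ F N θ.toStage9Params) (wOfRecord₉ F N θ.toStage9Params) θ.ppSel p
          (gOfRecord₁₀ F N θ.toStage9Params p) (k + 1) a V ≠ 0 ∧
        B15.BasicStep.fibreIntegral (fibOfSeq F θ.ν θ.τ9 p (gOfRecord₁₀ F N θ.toStage9Params p) (k + 1) a)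
          (rterm (sliceOfRecord F N θ.ν θ.τ9.M p (gOfRecord₁₀ F N θ.toStage9Params p) (k + 1)
            (slotsTOfRecord F N θ.ν θ.τ9 (EOfRecord₁₀ F N θ.toStage9Params) (wOfRecord₉ F N θ.toStage9Params) θ.ppSel p
              (gOfRecord₁₀ F N θ.toStage9Params p) (k + 1))) a) V ≠ 0) :
    densOfRecord₁₀ F N θ.toStage9Params p (k + 1) =ᵐ[fieldMeasure (F.P p.K) (k + 1) (SU N)] tdensOfRecord₁₀ F N θ.toStage9Params p k :=
  densOfRecord₁₂_succ_ae_eq_tdens_of_idem_of_dead F N θ p h k hk hidem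
    (fun a hne => fibreIntegral_termT₁₂_eq_zero_of_not_live F N θ p k a (hnl a hne))

end IdentityAERecord

end Literature.MathematicalPhysics.QuantumFieldTheory.Balaban1983to89.B16RLeafRecord12Live

end
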